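/-
Copyright: public-audit package `pub-balaban` (b2b-balaban), seat pv28-g11. Released under Apache 2.0 like Mathlib.
-/
import Literature.MathematicalPhysics.QuantumFieldTheory.Balaban1983to89.T4CubeChartTransport
import Literature.MathematicalPhysics.QuantumFieldTheory.Balaban1983to89.T4HaarSU2Translate
import Literature.MathematicalPhysics.QuantumFieldTheory.GaussianToolkit
import Literature.MathematicalPhysics.QuantumFieldTheory.LatticeMaxwellFreeEnergyLimit

/-!
# T4 — the cube chart of the `SU(2)` fibre: caveat (CHART) of `T4CubeChartTransport` for the production-type group,
# in the gnomonic window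

`Literature/MathematicalPhysics/QuantumFieldTheory/Balaban1983to89/`, namespace
`Literature.MathematicalPhysics.QuantumFieldTheory.Balaban1983to89.T4CubeChartGnomonic`.
Row `T4-O3.E-iii-b-G7-BLWINDOW-CHART-SU2*` of the pub-balaban cell (lineage pv28, gen 11; a kernel continuation of row
`T4-O3.E-iii-b-G7-BLWINDOW-CHART-U1*`, gen 10 (`T4CubeChartCircle`), under the cell's row-id policy T4-DAG §8 Q24(a);
cell records: GAPS G-pv28g10-1 = the (NONABELIAN) residue (N1)–(N4) of the `U(1)` chart, filed with
`t4/T4-EST-O3Eiiib-G7.md` §2sexies; this row's section there is §2octies).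
Versions: v1 (§1–§5, p186781); v1.1 = v1 + §6 «the Hessian of the Jacobian» (row
`T4-O3.E-iii-b-G7-BLWINDOW-CHART-SU2-JAC*`, same lineage; GAPS G-pv28g11-1 (b); p187099); v1.2 (this file) = v1.1 + §7
«the SU(2) plug with ACTION-ONLY convexity inputs» (row `T4-O3.E-iii-b-G7-BLWINDOW-CHART-SU2-PLUG*`, same lineage),
APPEND-ONLY: every declaration of §1–§6 is byte-identical to v1.1 (those of §1–§5 to v1); only this module docstring
and the new §7 differ.

## HONEST FRAMING

Nothing in this file is printed in Bałaban's papers and nothing is asserted about any of his densities, windows or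
exponents.  It DISCHARGES, for the non-abelian structure group `G = SU(2)` of the cell (`Matrix.specialUnitaryGroup
(Fin 2) ℂ` with the cell's instances `instGaugeGroupSpecialUnitaryGroup`, `instHaarDataSpecialUnitaryGroup` of
`UnitaryModel` — `HaarData.haar = haarProbability`, `rfl`, `T4HaarSU2Translate.haarData_haar_eq` — and the tree's Borel
structure), the change-of-variables HYPOTHESIS `CubeChart s χ u₀ n S φ jac` of `T4CubeChartTransport` (its caveat
(CHART); the (NONABELIAN) caveat of `T4CubeChartCircle`), in ONE concrete window geometry: for every bond set `s`,
reference field `u₀`, coordinate enumeration `e : s × Fin 3 ≃ Fin n` and half-width `S > 0`, the windowed base law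
`χ(u₀←y) · Haar^s(dy)` of the one-step fibre `(s → SU(2))`, with `χ` = the PRODUCT GNOMONIC WINDOW
`∏_{b ∈ s} 1[U(b) ∈ {u₀(b) P(1,v) : v ∈ [-S,S]³}]` (`P(1,v) = (1,v)/|(1,v)| ∈ S³ ≅ SU(2)`, the tree's
`quatToSU2 ∘ gnomonicQuat`), IS the image under the GNOMONIC FIBRE CHART `x ↦ (u₀(b) P(1, x_{e(b,·)}))_{b ∈ s}` of the
weighted cube law `e^{-jac_e} 1_{[-S,S]ⁿ} dx`, `n = 3·#s`, with the smooth, NON-constant log-Jacobian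
`jac_e(x) = Σ_{b ∈ s} [log(2π²) + 2 log(1 + |x_{e(b,·)}|²)]` (`cubeChart_specialUnitaryTwo`).  The three-dimensional
input is the tree's GNOMONIC INTEGRATION FORMULA for normalised Haar measure on `SU(2)`,
`∫ F dHaar = (2π²)⁻¹ ∫_{ℝ³} [F(P(1,v)) + F(P(-(1,v)))] (1+|v|²)⁻² dv` (`QuantumLattice.lintegral_haarProbability_su2_gnomonic`,
file `QuantumLattice/SU2HaarChart`): on the indicator of a subset of the window about `1` the antipodal term vanishes
(the window lies in the open hemisphere `Re > 0`, the antipodes in `Re < 0`) and the chart `v ↦ P(1,v)` is injective on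
all of `ℝ³`, so `Haar|_{window about 1} = (P(1,·))_* ((2π²)⁻¹ (1+|v|²)⁻² 1_{[-S,S]³} dv)`
(`haarProbability_restrict_gnoWindow_one`); left invariance of the Haar datum moves the window to any centre `g`
(`haar_restrict_gnoWindow`), and `measurePreserving_pi` together with a Lebesgue-measure-preserving regrouping
`ℝⁿ ≃ (s → ℝ³)` (Mathlib's `measurePreserving_piCongrLeft` and the tree's `LatticeMaxwell.volume_preserving_curry`)
assembles the fibre; the weight `e^{-jac_e}` is by construction the product of the one-bond gnomonic Haar weights
(`exp_neg_gnoJac`; `map_regroup_cubeWeighted`, Tonelli by the tree's `GaussianToolkit.lintegral_fintype_prod_eq_prod`).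
Imports: `…T4CubeChartTransport`, `…T4HaarSU2Translate` (the `SU(2)` quaternion dictionary and the gnomonic formula
`QuantumLattice.SU2HaarChart` behind it), hub-tree `…QuantumFieldTheory.GaussianToolkit` and
`…QuantumFieldTheory.LatticeMaxwellFreeEnergyLimit` (the two plumbing lemmas just named, BY NAME; nothing re-proved).
No upper restriction on `S` is needed (contrast (HALF) of the `U(1)` file): the gnomonic chart never reaches the
equator.  Against the cell's residue list G-pv28g10-1: (N3) (the Haar identity on the window) and (N4) (injectivity of
the chart on the window) are discharged here for the gnomonic chart, globally in `S`; (N2) (an explicit smooth `jac`) is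
discharged as a definition with `ContDiff ℝ m` for every `m`, its Hessian SIZED in §6 (v1.1: closed form, the global
lower bound `−½|w|²`, the window lower bound `4(1−3S²)/(1+3S²)²|w|²` on `[-S,S]ⁿ` for `S ≤ 1`; caveat (JAC)); (N1) (which window
Bałaban's small-field condition is, in exponential sup-norm coordinates or otherwise) is untouched (caveat
(GNOMONIC ≠ EXPONENTIAL)).

Consequence for the consumer `T4CubeChartTransport.mem_respDom_of_cubeChart` (the plug of the cube Brascamp–Lieb
engine into the (VAR) slots of the covariance response) and its vector forms `…_apply / _euclidean / _pi`: in the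
`SU(2)` case with the gnomonic window its chart hypothesis `hc` and its window hypotheses `hχm`, `hχ0`, `hbl` are
THEOREMS (`cubeChart_specialUnitaryTwo`, `measurable_windowDensity`, `windowDensity_nonneg`, `windowDensity_blind`),
the window-mass proviso `fibreIntegral s (χ·e^{h}) u₀ ≠ 0` is a THEOREM for bounded `h`
(`fibreIntegral_windowDensity_mul_exp_ne_zero`, with the explicit mass `(∫_{[-S,S]³} w)^{#s} ≥ ((2π²)⁻¹(1+3S²)⁻²(2S)³)^{#s}`,
`fibreIntegral_windowDensity`, `le_fibreIntegral_windowDensity`), and — since `jac_e` is NOT constant — the convexity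
input `λ` of its caveat (γ) is the convexity modulus on the cube of `x ↦ jac_e(x) − h(u₀←φ x)`, in which the Jacobian
term now genuinely enters (caveat (JAC)) — and is bounded below in closed form by §6 (v1.1): globally
`D²jac_e(x)(w,w) ≥ −½|w|²` (`hessianBound_gnoJac : HessianBound (gnoJac s e) (−½)`, the consumer's currency) and, on the
window cube `[-S,S]ⁿ` with `S ≤ 1`, `D²jac_e(x)(w,w) ≥ 4(1−3S²)/(1+3S²)²·|w|²` (POSITIVE iff `3S² < 1`; `= 4|w|²` at the
centre), so on small windows the Jacobian IMPROVES the modulus `λ` and costs at most `½` anywhere; §7 (v1.2) cashes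
the global bound into the consumer's plug: `mem_respDom_of_gnoChart` = `T4CubeChartTransport.mem_respDom_of_cubeChart`
for the gnomonic `SU(2)` window with its modulus inputs replaced by `C²` representatives `gᵢ` of the ACTION
`x ↦ −h(uᵢ ←_s φ x)` on the cube carrying `HessianBound gᵢ μ`, `μ > ½` (conclusion with `√(μ − ½)` in place of `√λ`).

## CITATION HEADER

No page of Bałaban's papers was read for this file; every declaration is tagged [folklore] (normalised Haar measure on
`SU(2) ≅ S³` in the gnomonic (central-projection) chart; push-forward, restriction, densities and finite products of
measures; currying and relabelling of Lebesgue measure).  0 [cite], 0 [model].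

## WHAT IS PROVED (CENSUS v1.1: 113 declarations — 1 abbreviation, 16 definitions, 1 instance, 95 theorems (v1: 87 =
1 + 13 + 1 + 72; §6 adds 3 definitions and 23 theorems); axioms {propext, Classical.choice, Quot.sound}; 0 sorry; no
local or scoped instances)

* §1 `SU2`; `qI`, `qJ`, `qK`; `gnoPoint v = P(1,v)` and `gnoChart g v = g P(1,v)` (continuous, measurable,
  `gnoPoint 0 = 1`, `gnoChart g 0 = g`); `su2Quat_gnoPoint` / `re_su2Quat_gnoPoint(_pos)` (the window hemisphere
  `Re > 0`), `re_su2Quat_antipode_neg` (antipodes in `Re < 0`); `gnoPoint_injective`, `gnoChart_injective` (on all of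
  `ℝ³`).
* §2 `gnoWindow g S = {g P(1,v) : v ∈ [-S,S]³}` (compact, measurable, `∋ g` for `S ≥ 0`, `preimage_gnoWindow` = the
  cube, `gnoWindow_one`, `gnoPoint_mem_gnoWindow_one_iff`, `antipode_not_mem_gnoWindow_one`, `gnoWindow_eq_image_mul`);
  the gnomonic Haar weight `gnoWeight v = (2π²)⁻¹ (1+|v|²)⁻²` (positive, `≤ (2π²)⁻¹`, measurable, continuous,
  `≥ (2π²)⁻¹(1+3S²)⁻²` on the cube, integrable on the cube); `gnoMeasure S = w 1_{[-S,S]³} dv` (finite);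
  `haarProbability_restrict_gnoWindow_one`; `haar_restrict_gnoWindow` / `measurePreserving_gnoChart`:
  `HaarData.haar|_{gnoWindow g S} = (gnoChart g)_* (gnoMeasure S)` for EVERY `S`; the window mass `haar_gnoWindow`
  (`= ∫_{[-S,S]³} w`, in `ℝ≥0∞` and, `haar_gnoWindow_eq_ofReal`, as a real integral), `le_haar_gnoWindow`,
  `haar_gnoWindow_pos` (`S > 0`), `volume_cube₃_toReal` (`= (2S)³`), `le_integral_gnoWeight`
  (`∫_{[-S,S]³} w ≥ (2π²)⁻¹(1+3S²)⁻²(2S)³`).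
* §3 `regroup s e : ℝⁿ ≃ᵐ (s → ℝ³)` (`regroup_apply`, `regroup_apply_eq`, `measurePreserving_regroup` w.r.t. Lebesgue
  measure, `regroup_preimage_pi_cube`: the big cube is the regrouped product of small cubes); the log-Jacobian
  `gnoJac s e` (`exp_neg_logWeight`, `exp_neg_gnoJac : e^{-jac_e(x)} = ∏_b w((regroup x)_b)`, `gnoJac_nonneg`,
  `measurable_gnoJac`, `contDiff_gnoJac` — `C^m` for every `m`); `map_regroup_cubeWeighted` /
  `measurePreserving_regroup_cubeWeighted`: `(regroup)_* (cubeWeighted n S jac_e) = ⨂_{b ∈ s} gnoMeasure S`;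
  `bondCoordEquiv s : s × Fin 3 ≃ Fin (3·#s)`.
* §4 `windowDensity s u₀ S` (measurable, `[0,1]`-valued, blind outside `s` (`windowDensity_congr`, `windowDensity_blind`),
  `= 1` at `u₀` for `S ≥ 0`, the indicator of the box `∏_b gnoWindow (u₀ b) S` on the fibre (`windowDensity_updateFinset`,
  `ofReal_windowDensity_updateFinset`, `fibreBase_withDensity_windowDensity`)); `gnoFibreChart s u₀ e`
  (`gnoFibreChart_eq_comp`, `measurePreserving_gnoFibreChart`); the instances `cubeChart_specialUnitaryTwo` (any
  `e : s × Fin 3 ≃ Fin n`, any `S > 0`), `cubeChart_specialUnitaryTwo_card` (`n = 3·#s`, `e = bondCoordEquiv s`),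
  `exists_cubeChart_specialUnitaryTwo` (with `ContDiff ℝ 2 jac`).
* §5 the WINDOW MASS: `fibreLaw_windowDensity` (`T4DressingDefect.fibreLaw` of the gnomonic window at `u₀` = the
  product of the restricted Haar data), `fibreLaw_windowDensity_univ` (`= ∏_b Haar(gnoWindow (u₀ b) S)` in `ℝ≥0∞`),
  `fibreIntegral_windowDensity` (`B15.BasicStep.fibreIntegral s χ u₀ = (∫_{[-S,S]³} w)^{#s}`),
  `le_fibreIntegral_windowDensity` (`≥ ((2π²)⁻¹(1+3S²)⁻²(2S)³)^{#s}`, `S ≥ 0`), `fibreIntegral_windowDensity_pos`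
  (`S > 0`); for a bounded exponent `|h| ≤ B`: `fibreIntegral_windowDensity_mul_exp_pos` / `…_ne_zero` — the
  window-mass proviso `fibreIntegral s (χ·e^{h}) u₀ ≠ 0` of `T4CovarianceResponse.meanLipschitz_of_varianceBound` (and of
  `T4CubeChartTransport` §2/§4) DISCHARGED for the gnomonic window (via `T4JointDressing.fibreIntegral_exp_dressed_pos`) —
  and `windowDensity_mul_exp_le` (`χ·e^{h} ≤ e^{B}`, the consumers' binder `hC`).
* §6 (v1.1) the HESSIAN OF THE JACOBIAN: per-bond block data `blkA e x b = 1 + Σ_i x_{e(b,i)}²` (`a_b ≥ 1`),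
  `blkB e x w b = Σ_i x_{e(b,i)} w_{e(b,i)}` (`β_b`), `blkC e w b = Σ_i w_{e(b,i)}²` (`γ_b ≥ 0`), with `β_b² ≤ (a_b−1)γ_b`
  (`blkB_sq_le`, Cauchy–Schwarz), `Σ_b γ_b = w·w` (`sum_blkC`), `a_b ≤ 1 + 3S²` on the cube (`blkA_le_of_mem_cube`);
  the Jacobian along a line `gnoJac_add_smul` (`jac_e(x+tw) = Σ_b [log 2π² + 2 log(a_b + 2β_b t + γ_b t²)]`), its
  first derivative `hasDerivAt_gnoJac_line` / `fderiv_gnoJac_line` (`D jac_e(x+tw)(w) = Σ_b 2(2β_b+2γ_b t)/(a_b+2β_b t+γ_b t²)`,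
  by the chain rule `hasDerivAt_gnoJac_line_fderiv` and uniqueness of derivatives), and the CLOSED FORM OF THE HESSIAN
  `fderiv_fderiv_gnoJac : D²jac_e(x)(w,w) = Σ_b [4γ_b/a_b − 8β_b²/a_b²]` (`= 4|w|²` at `x = 0`,
  `fderiv_fderiv_gnoJac_zero`); the bounds: per block `4γ/a − 8β²/a² ≥ 4γ(2−a)/a²` (`blk_hess_ge`), hence the GLOBAL
  bound `neg_half_mul_le_fderiv_fderiv_gnoJac : −½|w|² ≤ D²jac_e(x)(w,w)` (all `x, w`; elementary `blk_global_ge`: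
  `4γ(2−a)/a² ≥ −γ/2 ⟸ γ(a−4)² ≥ 0`) = `hessianBound_gnoJac : T4CubePoincare.HessianBound (gnoJac s e) (−½)` (via
  `T4CubePoincare.hessianBound_iff_fderiv`), and the WINDOW bound `window_mul_le_fderiv_fderiv_gnoJac :
  4(1−3S²)/(1+3S²)²·|w|² ≤ D²jac_e(x)(w,w)` for `x ∈ [-S,S]ⁿ`, `S ≤ 1` (elementary `ratio_anti`: `a ↦ (2−a)/a²`
  decreasing on `[1,4]`).
* §7 (v1.2) the SU(2) PLUG WITH ACTION-ONLY CONVEXITY INPUTS: `hessianBound_add` (for `C²` `f, g`: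
  `HessianBound f λ → HessianBound g μ → HessianBound (f + g) (λ + μ)`, by `T4CubePoincare.fderiv_fderiv_combo`),
  `contDiff_gnoJac_add`, `hessianBound_gnoJac_add` (`HessianBound (gnoJac s e + g) (μ − ½)` from `HessianBound g μ` and
  §6's `hessianBound_gnoJac`), and `mem_respDom_of_gnoChart`: the plug `T4CubeChartTransport.mem_respDom_of_cubeChart`
  SPECIALISED to the gnomonic `SU(2)` chart — its binders `hc`, `hχm`, `hχ0`, `hbl` discharged by §4, its modulus
  binders `hfᵢ`/`hBᵢ`/`agreeᵢ`/`hgap` replaced by `C²` representatives `g₀, g₁` of `x ↦ −h(u₀ ←_s φ x)`,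
  `x ↦ −h(u ←_s φ x)` on `[-S,S]ⁿ` with `HessianBound gᵢ μ`, `½ < μ`, and `|∇(g₁ − g₀)|² ≤ (b_H·dev u)²` on the cube —
  concluding `u ∈ respDom s (windowDensity s u₀ S) h u₀ B T dev (b_H/√(μ−½)) (L/√(μ−½))` (real inserts).

## CAVEATS

* (GNOMONIC ≠ EXPONENTIAL) The window is the gnomonic cube `{g P(1,v) : v ∈ [-S,S]³}`, NOT a sup-norm ball
  `{g exp(X) : X ∈ su(2), |X| ≤ ε}` in exponential coordinates and NOT a condition on `|U − 1|`; which small-field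
  window Bałaban's `R^{(j)}(V)` actually uses is NOT decided here (the cell's open reading question (N1) of GAPS
  G-pv28g10-1 stays open).  Untyped remark for orientation only: `P(1,v) = exp(X_v)` with `|X_v| = arctan |v|`, so the
  gnomonic cube of half-width `S` sits between the exponential balls of radii `arctan S` and `arctan (√3 S)`.
* (JAC) `jac_e` is smooth but NOT constant, so in caveat (γ) of `T4CubeChartTransport` the Hessian of `jac_e` enters the
  convexity modulus.  v1.1 §6 TYPES that Hessian: the closed form `fderiv_fderiv_gnoJac`, the global lower bound `−½`
  (`hessianBound_gnoJac`) and the window lower bound `4(1−3S²)/(1+3S²)²` on `[-S,S]ⁿ`, `S ≤ 1`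
  (`window_mul_le_fderiv_fderiv_gnoJac`; positive iff `3S² < 1`).  Untyped remarks for orientation only: on one bond
  `Hess_v [2 log(1+|v|²)]` has eigenvalues `4(1−|v|²)/(1+|v|²)²` (radial) and `4/(1+|v|²)` (tangential); the global
  constant `−½` is attained (one block with `|v|² = 3`, `w` radial there), the window constant is attained at a corner of
  the cube in the radial direction.  What §6 does NOT do: it sizes only the JACOBIAN half of `λ`; the concavity modulus of
  the action part `x ↦ h(u₀ ←_s φ_{u₀,e} x)` on the cube, and hence `λ` itself, stays with caveat (γ) of
  `T4CubeChartTransport` (untouched), as do (EXT) and (REAL).  §7 (v1.2) only re-packages: with the GLOBAL `−½` the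
  consumer's modulus binders become binders on `C²` representatives of the ACTION alone (`λ = μ − ½`); the window-local
  refinement (using `4(1−3S²)/(1+3S²)²` instead of `−½`) would need the untyped extension lemma (EXT) and is NOT typed;
  the vector-insert plugs `mem_respDom_of_cubeChart_apply/_euclidean/_pi` of `T4CubeChartTransport` §4 are not
  specialised here (verbatim analogues); `μ` itself is Bałaban-side (record (γ)) and is NOT sized.
* (SHARP-WINDOW) `χ` is the `{0,1}`-valued product gnomonic window — exactly the shape (CHART) asks for; a smooth cutoff
  is not of this shape, as recorded there.
* (RANK) Only `SU(2)`: `SU(N)`, `N ≥ 3` (no global chart of this kind; rank `N²−1`) and `U(N)` are not typed here.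
* (EXT), (REAL), (γ) of `T4CubeChartTransport` are untouched: this file supplies the chart, the window, its mass,
  (v1.1) the Hessian bounds of its Jacobian and (v1.2) the plug with the Jacobian half of `λ` absorbed, not the convexity
  modulus `μ` of the action, the `C²` representatives on `ℝⁿ` or the insert gradients.
* Value = kernel certificate that the hypothesis class `CubeChart` of the Brascamp–Lieb transport is INHABITED by the
  production-type group fibre `(s → SU(2))` with the cell's own `HaarData` and an honest non-constant Jacobian — NOT
  summit progress.
-/

noncomputable section

open _root_.MeasureTheory Set
open Function (updateFinset)
open scoped ENNReal Real Quaternion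

namespace Literature.MathematicalPhysics.QuantumFieldTheory.Balaban1983to89.T4CubeChartGnomonic

open Literature.MathematicalPhysics.QuantumLattice (quatToSU2 su2Quat gnomonicQuat continuousOn_quatToSU2
  gnomonicQuat_ne_zero norm_gnomonicQuat_pos lintegral_haarProbability_su2_gnomonic coe_quatToSU2_of_norm_eq_one
  quatMatrix_one)
open Literature.MathematicalPhysics.QuantumFieldTheory (haarProbability)
open Literature.Probability.Distributions (isCompact_cube integrableOn_cube)
open Literature.MathematicalPhysics.QuantumFieldTheory.GaussianToolkit (lintegral_fintype_prod_eq_prod)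
open Literature.MathematicalPhysics.QuantumFieldTheory.LatticeMaxwell (volume_preserving_curry)
open T4HaarSU2Translate (su2Quat_quatToSU2 haarData_haar_eq)
open T4TiltModulus T4CubePoincare T4CubeChartTransport


/-! ## §1  `SU(2)` of the cell and the gnomonic chart `v ↦ g · P(1, v)` -/

/-- `SU(2)` of the cell: `Matrix.specialUnitaryGroup (Fin 2) ℂ` with the cell's instances `instGaugeGroupSpecialUnitaryGroup`,
`instRegularGaugeGroupSpecialUnitaryGroup`, `instHaarDataSpecialUnitaryGroup` (`UnitaryModel`; `HaarData.haar = haarProbability`,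
`rfl`) and the tree's Borel structure. [folklore] -/
abbrev SU2 : Type := ↥(Matrix.specialUnitaryGroup (Fin 2) ℂ)

/-- THE GNOMONIC POINT of coordinate `v ∈ ℝ³`: the radial projection `P(1, v) = (1,v)/|(1,v)| ∈ S³ ≅ SU(2)` of the
quaternion `(1, v)` (the tree's `quatToSU2 ∘ gnomonicQuat`). [folklore] -/
def gnoPoint (v : Fin 3 → ℝ) : SU2 := quatToSU2 (gnomonicQuat v)

/-- THE GNOMONIC CHART about `g ∈ SU(2)`: `v ↦ g · P(1, v)`. [folklore] -/
def gnoChart (g : SU2) (v : Fin 3 → ℝ) : SU2 := g * gnoPoint v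

/-- The unit quaternion `i` (typed as an element of `ℍ`). [folklore] -/
def qI : ℍ := ⟨0, 1, 0, 0⟩

/-- The unit quaternion `j`. [folklore] -/
def qJ : ℍ := ⟨0, 0, 1, 0⟩

/-- The unit quaternion `k`. [folklore] -/
def qK : ℍ := ⟨0, 0, 0, 1⟩

/-- `(1, v) = 1 + v₀ i + v₁ j + v₂ k`. [folklore] -/
theorem gnomonicQuat_eq_lincomb (v : Fin 3 → ℝ) : gnomonicQuat v = 1 + v 0 • qI + v 1 • qJ + v 2 • qK := by
  ext <;> simp [gnomonicQuat, qI, qJ, qK]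

/-- `v ↦ (1, v)` is continuous. [folklore] -/
theorem continuous_gnomonicQuat : Continuous gnomonicQuat := by
  rw [show gnomonicQuat = fun v => 1 + v 0 • qI + v 1 • qJ + v 2 • qK from funext gnomonicQuat_eq_lincomb]
  fun_prop

/-- The gnomonic point depends continuously on its coordinate (`quatToSU2` is continuous off `0`). [folklore] -/
theorem continuous_gnoPoint : Continuous gnoPoint :=
  continuousOn_quatToSU2.comp_continuous continuous_gnomonicQuat fun v => gnomonicQuat_ne_zero v

/-- The gnomonic chart is continuous. [folklore] -/
theorem continuous_gnoChart (g : SU2) : Continuous (gnoChart g) :=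
  continuous_const.mul continuous_gnoPoint

/-- The gnomonic chart is measurable. [folklore] -/
theorem measurable_gnoChart (g : SU2) : Measurable (gnoChart g) := (continuous_gnoChart g).measurable

/-- `(1, 0) = 1`. [folklore] -/
theorem gnomonicQuat_zero : gnomonicQuat 0 = 1 := by
  ext <;> simp [gnomonicQuat]

/-- `P(1, 0) = 1`. [folklore] -/
theorem gnoPoint_zero : gnoPoint 0 = 1 := by
  apply Subtype.ext
  rw [gnoPoint, gnomonicQuat_zero, coe_quatToSU2_of_norm_eq_one norm_one, quatMatrix_one]
  rfl

/-- `gnoChart g 0 = g`. [folklore] -/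
theorem gnoChart_zero (g : SU2) : gnoChart g 0 = g := by
  rw [gnoChart, gnoPoint_zero, mul_one]

/-- The unit quaternion of the gnomonic point: `(1,v)/|(1,v)|`. [folklore] -/
theorem su2Quat_gnoPoint (v : Fin 3 → ℝ) : su2Quat (gnoPoint v) = ‖gnomonicQuat v‖⁻¹ • gnomonicQuat v :=
  su2Quat_quatToSU2 (gnomonicQuat_ne_zero v)

/-- Its real part is `|(1,v)|⁻¹ > 0`: gnomonic points lie in the open upper hemisphere. [folklore] -/
theorem re_su2Quat_gnoPoint (v : Fin 3 → ℝ) : (su2Quat (gnoPoint v)).re = ‖gnomonicQuat v‖⁻¹ := by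
  rw [su2Quat_gnoPoint, Quaternion.re_smul, smul_eq_mul]
  have h : (gnomonicQuat v).re = 1 := rfl
  rw [h, mul_one]

/-- … positive. [folklore] -/
theorem re_su2Quat_gnoPoint_pos (v : Fin 3 → ℝ) : 0 < (su2Quat (gnoPoint v)).re := by
  rw [re_su2Quat_gnoPoint]
  exact inv_pos.2 (norm_gnomonicQuat_pos v)

/-- The antipode `P(-(1,v))` lies in the open lower hemisphere. [folklore] -/
theorem re_su2Quat_antipode_neg (v : Fin 3 → ℝ) : (su2Quat (quatToSU2 (-gnomonicQuat v))).re < 0 := by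
  rw [su2Quat_quatToSU2 (neg_ne_zero.2 (gnomonicQuat_ne_zero v)), norm_neg, smul_neg, Quaternion.re_neg,
    Quaternion.re_smul, smul_eq_mul]
  have h : (gnomonicQuat v).re = 1 := rfl
  rw [h, mul_one, neg_lt_zero]
  exact inv_pos.2 (norm_gnomonicQuat_pos v)

/-- THE GNOMONIC CHART IS INJECTIVE (on all of `ℝ³`): `P(1,v) = P(1,w) → v = w`. [folklore] -/
theorem gnoPoint_injective : Function.Injective gnoPoint := fun v w h => by
  have hq : ‖gnomonicQuat v‖⁻¹ • gnomonicQuat v = ‖gnomonicQuat w‖⁻¹ • gnomonicQuat w := by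
    rw [← su2Quat_gnoPoint, ← su2Quat_gnoPoint, h]
  have hre : ‖gnomonicQuat v‖⁻¹ = ‖gnomonicQuat w‖⁻¹ := by
    have h1 := congrArg QuaternionAlgebra.re hq
    have h : (gnomonicQuat v).re = 1 := rfl
    have h' : (gnomonicQuat w).re = 1 := rfl
    simpa only [Quaternion.re_smul, h, h', smul_eq_mul, mul_one] using h1
  rw [hre] at hq
  have hvw : gnomonicQuat v = gnomonicQuat w :=
    smul_right_injective ℍ (inv_ne_zero (norm_gnomonicQuat_pos w).ne') hq
  funext i
  fin_cases i
  · exact congrArg QuaternionAlgebra.imI hvw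
  · exact congrArg QuaternionAlgebra.imJ hvw
  · exact congrArg QuaternionAlgebra.imK hvw

/-- … and so is `v ↦ g · P(1,v)`. [folklore] -/
theorem gnoChart_injective (g : SU2) : Function.Injective (gnoChart g) := fun _ _ h =>
  gnoPoint_injective (mul_left_cancel h)

/-! ## §2  The gnomonic cube window and the Haar measure on it -/

section Window

variable {g : SU2} {S : ℝ}

/-- THE GNOMONIC CUBE WINDOW of half-width `S` about `g ∈ SU(2)`: `{g · P(1,v) : v ∈ [-S,S]³}`. [folklore] -/
def gnoWindow (g : SU2) (S : ℝ) : Set SU2 := gnoChart g '' cube 3 S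

/-- The cube `[-S,S]³` is compact. [folklore] -/
theorem isCompact_cube₃ (S : ℝ) : IsCompact (cube 3 S) := isCompact_cube 3 S

/-- The window is compact. [folklore] -/
theorem isCompact_gnoWindow : IsCompact (gnoWindow g S) := (isCompact_cube₃ S).image (continuous_gnoChart g)

/-- The window is measurable. [folklore] -/
theorem measurableSet_gnoWindow : MeasurableSet (gnoWindow g S) := isCompact_gnoWindow.isClosed.measurableSet

/-- `0 ∈ [-S,S]³` for `S ≥ 0`. [folklore] -/
theorem zero_mem_cube₃ (hS : 0 ≤ S) : (0 : Fin 3 → ℝ) ∈ cube 3 S :=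
  mem_cube_iff.2 fun _ => by simpa using hS

/-- The centre lies in its window (`S ≥ 0`). [folklore] -/
theorem mem_gnoWindow_self (hS : 0 ≤ S) : g ∈ gnoWindow g S := ⟨0, zero_mem_cube₃ hS, gnoChart_zero g⟩

/-- The coordinates landing in the window are exactly the cube (injectivity). [folklore] -/
theorem preimage_gnoWindow (g : SU2) (S : ℝ) : gnoChart g ⁻¹' gnoWindow g S = cube 3 S :=
  (gnoChart_injective g).preimage_image _

/-- The window about `1` is the set of gnomonic points of the cube. [folklore] -/
theorem gnoWindow_one : gnoWindow 1 S = gnoPoint '' cube 3 S :=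
  image_congr fun v _ => by rw [gnoChart, one_mul]

/-- `P(1,v)` lies in the window about `1` iff `v ∈ [-S,S]³`. [folklore] -/
theorem gnoPoint_mem_gnoWindow_one_iff (v : Fin 3 → ℝ) : gnoPoint v ∈ gnoWindow 1 S ↔ v ∈ cube 3 S := by
  rw [gnoWindow_one, gnoPoint_injective.mem_set_image]

/-- The antipode `P(-(1,v))` is never in the window about `1` (wrong hemisphere). [folklore] -/
theorem antipode_not_mem_gnoWindow_one (v : Fin 3 → ℝ) (S : ℝ) : quatToSU2 (-gnomonicQuat v) ∉ gnoWindow 1 S := by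
  rw [gnoWindow_one]
  rintro ⟨w, -, hw⟩
  have h1 := re_su2Quat_gnoPoint_pos w
  rw [hw] at h1
  exact lt_asymm h1 (re_su2Quat_antipode_neg v)

/-- The window about `g` is the left translate of the window about `1`. [folklore] -/
theorem gnoWindow_eq_image_mul (g : SU2) (S : ℝ) : gnoWindow g S = (fun h : SU2 => g * h) '' gnoWindow 1 S := by
  rw [gnoWindow_one, image_image]
  rfl

/-- THE GNOMONIC HAAR WEIGHT `w(v) = (2π²)⁻¹ (1 + |v|²)⁻²`: the density of normalised Haar measure in the gnomonic chart
(`QuantumLattice.lintegral_haarProbability_su2_gnomonic`). [folklore] -/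
def gnoWeight (v : Fin 3 → ℝ) : ℝ := (2 * π ^ 2)⁻¹ * ((1 + ∑ i, v i ^ 2)⁻¹) ^ 2

/-- `w > 0`. [folklore] -/
theorem gnoWeight_pos (v : Fin 3 → ℝ) : 0 < gnoWeight v := by
  unfold gnoWeight; positivity

/-- `w ≤ (2π²)⁻¹`. [folklore] -/
theorem gnoWeight_le (v : Fin 3 → ℝ) : gnoWeight v ≤ (2 * π ^ 2)⁻¹ := by
  have hq : (1 : ℝ) ≤ 1 + ∑ i, v i ^ 2 := le_add_of_nonneg_right (Finset.sum_nonneg fun i _ => sq_nonneg (v i))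
  have h1 : ((1 + ∑ i, v i ^ 2)⁻¹) ^ 2 ≤ 1 :=
    pow_le_one₀ (inv_nonneg.2 (zero_le_one.trans hq)) (inv_le_one_of_one_le₀ hq)
  exact mul_le_of_le_one_right (by positivity) h1

/-- `w` is measurable. [folklore] -/
theorem measurable_gnoWeight : Measurable gnoWeight := by
  unfold gnoWeight
  exact measurable_const.mul
    ((measurable_const.add (Finset.measurable_sum _ fun i _ => (measurable_pi_apply i).pow_const 2)).inv.pow_const 2)

/-- `w` is continuous. [folklore] -/
theorem continuous_gnoWeight : Continuous gnoWeight := by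
  unfold gnoWeight
  refine continuous_const.mul ((Continuous.inv₀ ?_ fun v => ?_).pow 2)
  · fun_prop
  · positivity

/-- On the cube `[-S,S]³` the weight is bounded below by `(2π²)⁻¹ (1 + 3S²)⁻²`. [folklore] -/
theorem gnoWeight_ge_of_mem_cube {v : Fin 3 → ℝ} (hv : v ∈ cube 3 S) :
    (2 * π ^ 2)⁻¹ * ((1 + 3 * S ^ 2)⁻¹) ^ 2 ≤ gnoWeight v := by
  have hs : ∑ i, v i ^ 2 ≤ 3 * S ^ 2 := by
    have hi : ∀ i, v i ^ 2 ≤ S ^ 2 := fun i => by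
      have := (mem_cube_iff.1 hv) i
      exact sq_le_sq' (abs_le.1 this).1 (abs_le.1 this).2
    calc ∑ i, v i ^ 2 ≤ ∑ _i : Fin 3, S ^ 2 := Finset.sum_le_sum fun i _ => hi i
      _ = 3 * S ^ 2 := by rw [Finset.sum_const, Finset.card_univ, Fintype.card_fin]; ring
  have hq : (0 : ℝ) < 1 + ∑ i, v i ^ 2 := by positivity
  unfold gnoWeight
  refine mul_le_mul_of_nonneg_left (pow_le_pow_left₀ (by positivity) (inv_anti₀ hq (by linarith)) 2) (by positivity)

/-- THE GNOMONIC MEASURE on the cube: `w(v) 1_{[-S,S]³}(v) dv`. [folklore] -/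
def gnoMeasure (S : ℝ) : Measure (Fin 3 → ℝ) :=
  (volume.restrict (cube 3 S)).withDensity fun v => ENNReal.ofReal (gnoWeight v)

/-- The gnomonic measure on a cube is finite. [folklore] -/
instance isFiniteMeasure_gnoMeasure (S : ℝ) : IsFiniteMeasure (gnoMeasure S) := by
  refine isFiniteMeasure_withDensity (ne_top_of_le_ne_top ?_
    (lintegral_mono fun v => ENNReal.ofReal_le_ofReal (gnoWeight_le v)))
  rw [lintegral_const, Measure.restrict_apply_univ]
  exact ENNReal.mul_ne_top ENNReal.ofReal_ne_top (isCompact_cube₃ S).measure_lt_top.ne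

/-- **NORMALISED HAAR MEASURE ON `SU(2)` IN THE GNOMONIC CUBE WINDOW ABOUT `1`**: its restriction to
`{P(1,v) : v ∈ [-S,S]³}` is the image of `(2π²)⁻¹ (1+|v|²)⁻² 1_{[-S,S]³} dv` under `v ↦ P(1,v)` — the tree's gnomonic
integration formula on indicators, the antipodal hemisphere contributing nothing and the chart being injective. [folklore] -/
theorem haarProbability_restrict_gnoWindow_one (S : ℝ) :
    (haarProbability SU2).restrict (gnoWindow 1 S) = (gnoMeasure S).map gnoPoint := by
  have hW : MeasurableSet (gnoWindow (1 : SU2) S) := measurableSet_gnoWindow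
  have hc : Measurable gnoPoint := continuous_gnoPoint.measurable
  refine Measure.ext fun A hA => ?_
  have hB : MeasurableSet (gnoPoint ⁻¹' A ∩ cube 3 S) := (hc hA).inter (measurableSet_cube' 3 S)
  rw [Measure.restrict_apply hA, Measure.map_apply hc hA, gnoMeasure, withDensity_apply _ (hc hA),
    Measure.restrict_restrict (hc hA), ← lintegral_indicator_one (hA.inter hW),
    lintegral_haarProbability_su2_gnomonic _ (measurable_one.indicator (hA.inter hW))]
  have hpt : ∀ v : Fin 3 → ℝ,
      ((A ∩ gnoWindow 1 S).indicator (1 : SU2 → ℝ≥0∞) (quatToSU2 (gnomonicQuat v)) +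
          (A ∩ gnoWindow 1 S).indicator 1 (quatToSU2 (-gnomonicQuat v))) *
        ENNReal.ofReal (((1 + ∑ i, v i ^ 2)⁻¹) ^ 2) =
      (gnoPoint ⁻¹' A ∩ cube 3 S).indicator (fun v => ENNReal.ofReal (((1 + ∑ i, v i ^ 2)⁻¹) ^ 2)) v := by
    intro v
    have h2 : (A ∩ gnoWindow 1 S).indicator (1 : SU2 → ℝ≥0∞) (quatToSU2 (-gnomonicQuat v)) = 0 :=
      indicator_of_notMem (fun h => antipode_not_mem_gnoWindow_one v S h.2) _
    rw [h2, add_zero]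
    by_cases hv : v ∈ gnoPoint ⁻¹' A ∩ cube 3 S
    · have h' : gnoPoint v ∈ A ∩ gnoWindow 1 S := ⟨hv.1, (gnoPoint_mem_gnoWindow_one_iff v).2 hv.2⟩
      rw [indicator_of_mem hv, show quatToSU2 (gnomonicQuat v) = gnoPoint v from rfl, indicator_of_mem h',
        Pi.one_apply, one_mul]
    · have h' : gnoPoint v ∉ A ∩ gnoWindow 1 S := fun h => hv ⟨h.1, (gnoPoint_mem_gnoWindow_one_iff v).1 h.2⟩
      rw [indicator_of_notMem hv, show quatToSU2 (gnomonicQuat v) = gnoPoint v from rfl, indicator_of_notMem h',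
        zero_mul]
  rw [lintegral_congr hpt, lintegral_indicator hB, ← lintegral_const_mul' _ _ ENNReal.ofReal_ne_top]
  refine lintegral_congr fun v => ?_
  rw [gnoWeight, ENNReal.ofReal_mul (by positivity), one_div]

/-- **THE HAAR DATUM ON A GNOMONIC CUBE WINDOW**: for every `g ∈ SU(2)` and every `S`, the cell's `HaarData.haar`
restricted to `{g P(1,v) : v ∈ [-S,S]³}` is the image of the gnomonic measure under `v ↦ g P(1,v)` (left invariance
of the Haar datum + the window about `1`). No upper restriction on `S` is needed: the chart is injective on `ℝ³`.
[folklore] -/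
theorem haar_restrict_gnoWindow (g : SU2) (S : ℝ) :
    (HaarData.haar : Measure SU2).restrict (gnoWindow g S) = (gnoMeasure S).map (gnoChart g) := by
  have hm : Measurable fun h : SU2 => g * h := measurable_const_mul g
  calc (HaarData.haar : Measure SU2).restrict (gnoWindow g S)
      = ((HaarData.haar : Measure SU2).map (fun h => g * h)).restrict (gnoWindow g S) := by
        rw [HaarData.map_mul_left]
    _ = ((HaarData.haar : Measure SU2).restrict ((fun h => g * h) ⁻¹' gnoWindow g S)).map (fun h => g * h) :=
        Measure.restrict_map hm measurableSet_gnoWindow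
    _ = ((HaarData.haar : Measure SU2).restrict (gnoWindow 1 S)).map (fun h => g * h) := by
        rw [gnoWindow_eq_image_mul g S, (mul_right_injective g).preimage_image]
    _ = ((gnoMeasure S).map gnoPoint).map (fun h => g * h) := by
        rw [haarData_haar_eq, haarProbability_restrict_gnoWindow_one]
    _ = (gnoMeasure S).map (gnoChart g) := by
        rw [Measure.map_map hm continuous_gnoPoint.measurable]
        rfl

/-- `v ↦ g P(1,v)` is measure preserving from the gnomonic measure on `[-S,S]³` to the Haar datum on the window.
[folklore] -/
theorem measurePreserving_gnoChart (g : SU2) (S : ℝ) :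
    MeasurePreserving (gnoChart g) (gnoMeasure S) ((HaarData.haar : Measure SU2).restrict (gnoWindow g S)) :=
  ⟨measurable_gnoChart g, (haar_restrict_gnoWindow g S).symm⟩

/-- The Haar mass of the window as a cube integral: `∫_{[-S,S]³} (2π²)⁻¹ (1+|v|²)⁻² dv`. [folklore] -/
theorem haar_gnoWindow (g : SU2) (S : ℝ) :
    (HaarData.haar : Measure SU2) (gnoWindow g S) = ∫⁻ v in cube 3 S, ENNReal.ofReal (gnoWeight v) := by
  rw [← Measure.restrict_apply_univ, haar_restrict_gnoWindow, Measure.map_apply (measurable_gnoChart g)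
    MeasurableSet.univ, preimage_univ, gnoMeasure, withDensity_apply _ MeasurableSet.univ, Measure.restrict_univ]

/-- LOWER BOUND: the window of half-width `S > 0` has Haar mass `≥ (2π²)⁻¹ (1+3S²)⁻² (2S)³ > 0`. [folklore] -/
theorem le_haar_gnoWindow (g : SU2) (S : ℝ) :
    ENNReal.ofReal ((2 * π ^ 2)⁻¹ * ((1 + 3 * S ^ 2)⁻¹) ^ 2) * volume (cube 3 S) ≤
      (HaarData.haar : Measure SU2) (gnoWindow g S) := by
  rw [haar_gnoWindow, ← setLIntegral_const]
  exact setLIntegral_mono (ENNReal.measurable_ofReal.comp measurable_gnoWeight)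
    fun v hv => ENNReal.ofReal_le_ofReal (gnoWeight_ge_of_mem_cube hv)

/-- The window of half-width `S > 0` has positive Haar mass. [folklore] -/
theorem haar_gnoWindow_pos (g : SU2) (hS : 0 < S) : 0 < (HaarData.haar : Measure SU2) (gnoWindow g S) :=
  lt_of_lt_of_le (ENNReal.mul_pos (ENNReal.ofReal_pos.2 (by positivity)).ne' (volume_cube_pos' 3 hS).ne')
    (le_haar_gnoWindow g S)

/-- `w` is integrable on the cube. [folklore] -/
theorem integrableOn_gnoWeight (S : ℝ) : IntegrableOn gnoWeight (cube 3 S) volume :=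
  integrableOn_cube continuous_gnoWeight S

/-- The Haar mass of the window as a REAL cube integral: `Haar(gnoWindow g S) = ∫_{[-S,S]³} w(v) dv`. [folklore] -/
theorem haar_gnoWindow_eq_ofReal (g : SU2) (S : ℝ) :
    (HaarData.haar : Measure SU2) (gnoWindow g S) = ENNReal.ofReal (∫ v in cube 3 S, gnoWeight v) := by
  rw [haar_gnoWindow, ofReal_integral_eq_lintegral_ofReal (integrableOn_gnoWeight S)
    (ae_of_all _ fun v => (gnoWeight_pos v).le)]

/-- The volume of `[-S,S]³` is `(2S)³` (`S ≥ 0`). [folklore] -/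
theorem volume_cube₃_toReal (hS : 0 ≤ S) : (volume (cube 3 S)).toReal = (2 * S) ^ 3 := by
  rw [cube_eq, Set.pi_univ_Icc, Real.volume_Icc_pi_toReal (fun _ => by simpa using neg_le_self hS)]
  simp only [sub_neg_eq_add, Finset.prod_const, Finset.card_univ, Fintype.card_fin]
  ring

/-- LOWER BOUND in `ℝ`: `∫_{[-S,S]³} w ≥ (2π²)⁻¹ (1+3S²)⁻² (2S)³` (`S ≥ 0`). [folklore] -/
theorem le_integral_gnoWeight (hS : 0 ≤ S) :
    (2 * π ^ 2)⁻¹ * ((1 + 3 * S ^ 2)⁻¹) ^ 2 * (2 * S) ^ 3 ≤ ∫ v in cube 3 S, gnoWeight v := by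
  have h := setIntegral_mono_on (μ := volume) (s := cube 3 S) (integrableOn_cube continuous_const S)
    (integrableOn_gnoWeight S) (measurableSet_cube' 3 S) fun v hv => gnoWeight_ge_of_mem_cube hv
  rw [setIntegral_const, smul_eq_mul, measureReal_def, volume_cube₃_toReal hS] at h
  linarith

end Window

/-! ## §3  Regrouping the cube coordinates by bond, and the log-Jacobian -/

section Regroup

variable {P : Params} {j : ℕ} {s : Finset (PBond P j)} {n : ℕ}

/-- REGROUPING of the `n = 3·#s` cube coordinates by bond along an enumeration `e : s × Fin 3 ≃ Fin n`:
`(Ψ_e x)_b = (x_{e(b,0)}, x_{e(b,1)}, x_{e(b,2)})`, a measurable equivalence `ℝⁿ ≃ (s → ℝ³)` (Mathlib's relabelling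
`piCongrLeft` followed by currying). [folklore] -/
def regroup (s : Finset (PBond P j)) (e : ↥s × Fin 3 ≃ Fin n) : (Fin n → ℝ) ≃ᵐ (↥s → Fin 3 → ℝ) :=
  (MeasurableEquiv.piCongrLeft (fun _ : ↥s × Fin 3 => ℝ) e.symm).trans (MeasurableEquiv.curry ↥s (Fin 3) ℝ)

/-- `(Ψ_e x)_b i = x_{e(b,i)}`. [folklore] -/
theorem regroup_apply (e : ↥s × Fin 3 ≃ Fin n) (x : Fin n → ℝ) (b : ↥s) (i : Fin 3) :
    regroup s e x b i = x (e (b, i)) := by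
  have h := MeasurableEquiv.piCongrLeft_apply_apply (β := fun _ : ↥s × Fin 3 => ℝ) e.symm x (e (b, i))
  rw [e.symm_apply_apply] at h
  rw [← h]
  rfl

/-- `(Ψ_e x)_b = (x_{e(b,i)})_i`. [folklore] -/
theorem regroup_apply_eq (e : ↥s × Fin 3 ≃ Fin n) (x : Fin n → ℝ) (b : ↥s) :
    regroup s e x b = fun i => x (e (b, i)) :=
  funext (regroup_apply e x b)

/-- Regrouping preserves Lebesgue measure. [folklore] -/
theorem measurePreserving_regroup (e : ↥s × Fin 3 ≃ Fin n) : MeasurePreserving (regroup s e) volume volume :=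
  (volume_measurePreserving_piCongrLeft (fun _ : ↥s × Fin 3 => ℝ) e.symm).trans (volume_preserving_curry ↥s (Fin 3))

/-- The big cube is the regrouped product of the small cubes: `Ψ_e⁻¹(∏_b [-S,S]³) = [-S,S]ⁿ`. [folklore] -/
theorem regroup_preimage_pi_cube (e : ↥s × Fin 3 ≃ Fin n) (S : ℝ) :
    regroup s e ⁻¹' Set.pi univ (fun _ : ↥s => cube 3 S) = cube n S := by
  ext x
  simp only [mem_preimage, mem_univ_pi, mem_cube_iff, regroup_apply]
  constructor
  · intro h k
    obtain ⟨⟨b, i⟩, rfl⟩ := e.surjective k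
    exact h b i
  · intro h b i
    exact h _

/-- **THE LOG-JACOBIAN OF THE GNOMONIC FIBRE CHART**: `jac_e(x) = Σ_{b ∈ s} [log(2π²) + 2 log(1 + Σ_i x_{e(b,i)}²)]`, so that
`e^{-jac_e(x)} = ∏_b (2π²)⁻¹ (1 + |x_{e(b,·)}|²)⁻²` is the product of the gnomonic Haar weights (`exp_neg_gnoJac`).  It is
smooth and NOT constant (caveat (JAC)). [folklore] -/
def gnoJac (s : Finset (PBond P j)) (e : ↥s × Fin 3 ≃ Fin n) (x : Fin n → ℝ) : ℝ :=
  ∑ b : ↥s, (Real.log (2 * π ^ 2) + 2 * Real.log (1 + ∑ i : Fin 3, x (e (b, i)) ^ 2))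

/-- One bond: `exp(-(log(2π²) + 2 log(1+|v|²))) = (2π²)⁻¹ (1+|v|²)⁻² = w(v)`. [folklore] -/
theorem exp_neg_logWeight (v : Fin 3 → ℝ) :
    Real.exp (-(Real.log (2 * π ^ 2) + 2 * Real.log (1 + ∑ i, v i ^ 2))) = gnoWeight v := by
  have hq : (0 : ℝ) < 1 + ∑ i, v i ^ 2 := by positivity
  have hc : (0 : ℝ) < 2 * π ^ 2 := by positivity
  have h2 : (2 : ℝ) * Real.log (1 + ∑ i, v i ^ 2) = Real.log ((1 + ∑ i, v i ^ 2) ^ 2) := by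
    rw [Real.log_pow]; norm_num
  rw [h2, Real.exp_neg, Real.exp_add, Real.exp_log hc, Real.exp_log (pow_pos hq 2), gnoWeight, mul_inv, inv_pow]

/-- `e^{-jac_e(x)} = ∏_b w((Ψ_e x)_b)`. [folklore] -/
theorem exp_neg_gnoJac (e : ↥s × Fin 3 ≃ Fin n) (x : Fin n → ℝ) :
    Real.exp (-gnoJac s e x) = ∏ b : ↥s, gnoWeight (regroup s e x b) := by
  rw [gnoJac, ← Finset.sum_neg_distrib, Real.exp_sum]
  refine Finset.prod_congr rfl fun b _ => ?_
  rw [regroup_apply_eq]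
  exact exp_neg_logWeight _

/-- `0 < e^{-jac}`-type positivity: `jac_e` is a finite sum of logarithms of numbers `≥ 1` and `log(2π²) > 0`, hence
`jac_e ≥ 0`. [folklore] -/
theorem gnoJac_nonneg (e : ↥s × Fin 3 ≃ Fin n) (x : Fin n → ℝ) : 0 ≤ gnoJac s e x := by
  refine Finset.sum_nonneg fun b _ => add_nonneg (Real.log_nonneg ?_) (mul_nonneg zero_le_two (Real.log_nonneg ?_))
  · nlinarith [Real.pi_gt_three]
  · exact le_add_of_nonneg_right (Finset.sum_nonneg fun i _ => sq_nonneg _)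

/-- `jac_e` is measurable. [folklore] -/
theorem measurable_gnoJac (e : ↥s × Fin 3 ≃ Fin n) : Measurable (gnoJac s e) := by
  refine Finset.measurable_sum _ fun b _ => measurable_const.add (Measurable.const_mul ?_ 2)
  exact Real.measurable_log.comp
    (measurable_const.add (Finset.measurable_sum _ fun i _ => (measurable_pi_apply _).pow_const 2))

/-- `jac_e` is smooth (`C^m` for every `m`): each `1 + Σ_i x_{e(b,i)}² ≥ 1` stays away from the singularity of `log`.
[folklore] -/
theorem contDiff_gnoJac (e : ↥s × Fin 3 ≃ Fin n) {m : WithTop ℕ∞} : ContDiff ℝ m (gnoJac s e) := by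
  unfold gnoJac
  refine ContDiff.sum fun b _ => contDiff_const.add (ContDiff.mul contDiff_const (ContDiff.log ?_ fun x => ?_))
  · exact contDiff_const.add (ContDiff.sum fun i _ => (contDiff_apply ℝ ℝ (e (b, i))).pow 2)
  · positivity

/-- **THE WEIGHTED CUBE, REGROUPED, IS THE PRODUCT OF THE GNOMONIC MEASURES**:
`(Ψ_e)_* (e^{-jac_e} 1_{[-S,S]ⁿ} dx) = ⨂_{b ∈ s} w(v) 1_{[-S,S]³} dv` — regrouping preserves Lebesgue measure, carries the
big cube to the product of small cubes and the weight `e^{-jac_e}` to the product weight; Tonelli on boxes and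
uniqueness of product measures (`Measure.pi_eq`). [folklore] -/
theorem map_regroup_cubeWeighted (e : ↥s × Fin 3 ≃ Fin n) (S : ℝ) :
    (cubeWeighted n S (gnoJac s e)).map (regroup s e) = Measure.pi fun _ : ↥s => gnoMeasure S := by
  symm
  refine Measure.pi_eq fun t ht => ?_
  have hΨ := measurePreserving_regroup e
  have hpre : MeasurableSet (regroup s e ⁻¹' Set.pi univ t) := (regroup s e).measurable (MeasurableSet.univ_pi ht)
  have hset : regroup s e ⁻¹' Set.pi univ t ∩ cube n S = regroup s e ⁻¹' Set.pi univ (fun b => t b ∩ cube 3 S) := by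
    rw [← regroup_preimage_pi_cube e S, ← preimage_inter, ← pi_inter_distrib]
  have hwm : Measurable fun v : Fin 3 → ℝ => ENNReal.ofReal (gnoWeight v) :=
    ENNReal.measurable_ofReal.comp measurable_gnoWeight
  rw [MeasurableEquiv.map_apply, cubeWeighted, withDensity_apply _ hpre, Measure.restrict_restrict hpre, hset]
  calc ∫⁻ x in regroup s e ⁻¹' Set.pi univ (fun b => t b ∩ cube 3 S), ENNReal.ofReal (Real.exp (-gnoJac s e x))
      = ∫⁻ x in regroup s e ⁻¹' Set.pi univ (fun b => t b ∩ cube 3 S),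
          ∏ b : ↥s, ENNReal.ofReal (gnoWeight (regroup s e x b)) := by
        refine lintegral_congr fun x => ?_
        rw [exp_neg_gnoJac, ENNReal.ofReal_prod_of_nonneg fun b _ => (gnoWeight_pos _).le]
    _ = ∫⁻ y in Set.pi univ (fun b => t b ∩ cube 3 S), ∏ b : ↥s, ENNReal.ofReal (gnoWeight (y b)) :=
        hΨ.setLIntegral_comp_preimage_emb (regroup s e).measurableEmbedding
          (fun y : ↥s → Fin 3 → ℝ => ∏ b : ↥s, ENNReal.ofReal (gnoWeight (y b))) _
    _ = ∫⁻ y, ∏ b : ↥s, ENNReal.ofReal (gnoWeight (y b))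
          ∂(Measure.pi fun b : ↥s => (volume : Measure (Fin 3 → ℝ)).restrict (t b ∩ cube 3 S)) := by
        rw [volume_pi, Measure.restrict_pi_pi]
    _ = ∏ b : ↥s, ∫⁻ v in t b ∩ cube 3 S, ENNReal.ofReal (gnoWeight v) :=
        lintegral_fintype_prod_eq_prod _ fun _ => hwm
    _ = ∏ b : ↥s, gnoMeasure S (t b) := Finset.prod_congr rfl fun b _ => by
        rw [gnoMeasure, withDensity_apply _ (ht b), Measure.restrict_restrict (ht b)]

/-- The same as a measure-preserving statement. [folklore] -/
theorem measurePreserving_regroup_cubeWeighted (e : ↥s × Fin 3 ≃ Fin n) (S : ℝ) :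
    MeasurePreserving (regroup s e) (cubeWeighted n S (gnoJac s e)) (Measure.pi fun _ : ↥s => gnoMeasure S) :=
  ⟨(regroup s e).measurable, map_regroup_cubeWeighted e S⟩

/-- THE CANONICAL ENUMERATION `s × Fin 3 ≃ Fin (3·#s)` (bond-major: Mathlib's `Finset.equivFin` and `finProdFinEquiv`).
[folklore] -/
def bondCoordEquiv (s : Finset (PBond P j)) : ↥s × Fin 3 ≃ Fin (s.card * 3) :=
  (Equiv.prodCongr s.equivFin (Equiv.refl (Fin 3))).trans finProdFinEquiv

end Regroup

/-! ## §4  The `SU(2)` fibre: product gnomonic window, gnomonic fibre chart, and the chart hypothesis -/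

section Fibre

variable {P : Params} {j : ℕ}

/-- **THE PRODUCT GNOMONIC WINDOW** about the reference field `u₀` on the bonds of `s`, as a density:
`χ_{s,u₀,S}(U) = ∏_{b ∈ s} 1[U(b) ∈ gnoWindow (u₀ b) S]` (`{0,1}`-valued, blind to the bonds outside `s`). [folklore] -/
def windowDensity (s : Finset (PBond P j)) (u₀ : GaugeField P j SU2) (S : ℝ) : Density P j SU2 :=
  fun U => ∏ b ∈ s, (gnoWindow (u₀ b) S).indicator (fun _ => (1 : ℝ)) (U b)

/-- **THE GNOMONIC FIBRE CHART** through `s` about `u₀`, along an enumeration `e : s × Fin 3 ≃ Fin n` of the coordinates: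
`x ↦ (b ↦ u₀(b) · P(1, x_{e(b,·)}))`. [folklore] -/
def gnoFibreChart (s : Finset (PBond P j)) (u₀ : GaugeField P j SU2) {n : ℕ} (e : ↥s × Fin 3 ≃ Fin n) :
    (Fin n → ℝ) → (↥s → SU2) :=
  fun x b => gnoChart (u₀ b) (fun i => x (e (b, i)))

variable {s : Finset (PBond P j)} {u₀ : GaugeField P j SU2} {S : ℝ} {n : ℕ}

/-- The product window is measurable. [folklore] -/
theorem measurable_windowDensity (s : Finset (PBond P j)) (u₀ : GaugeField P j SU2) (S : ℝ) :
    Measurable (windowDensity s u₀ S) := by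
  refine Finset.measurable_prod s fun b _ => ?_
  exact (measurable_const.indicator measurableSet_gnoWindow).comp (measurable_pi_apply (b : PBond P j))

/-- The product window is non-negative. [folklore] -/
theorem windowDensity_nonneg (U : GaugeField P j SU2) : 0 ≤ windowDensity s u₀ S U :=
  Finset.prod_nonneg fun _ _ => Set.indicator_nonneg (fun _ _ => zero_le_one) _

/-- The product window takes values in `[0, 1]`. [folklore] -/
theorem windowDensity_le_one (U : GaugeField P j SU2) : windowDensity s u₀ S U ≤ 1 :=
  Finset.prod_le_one (fun _ _ => Set.indicator_nonneg (fun _ _ => zero_le_one) _)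
    fun _ _ => Set.indicator_apply_le' (fun _ => le_rfl) (fun _ => zero_le_one)

/-- The product window is BLIND outside `s`. [folklore] -/
theorem windowDensity_congr {U V : GaugeField P j SU2} (h : ∀ b ∈ s, U b = V b) :
    windowDensity s u₀ S U = windowDensity s u₀ S V :=
  Finset.prod_congr rfl fun b hb => by rw [h b hb]

/-- The reference field lies in its own gnomonic window (`S ≥ 0`): `χ_{s,u₀,S}(u₀) = 1`. [folklore] -/
theorem windowDensity_self (u₀ : GaugeField P j SU2) (hS : 0 ≤ S) : windowDensity s u₀ S u₀ = 1 :=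
  Finset.prod_eq_one fun _ _ => Set.indicator_of_mem (mem_gnoWindow_self hS) _

/-- The gnomonic fibre chart factors as the regrouping `ℝⁿ ≃ (s → ℝ³)` followed by the bondwise charts
`v ↦ u₀(b) P(1,v)`. [folklore] -/
theorem gnoFibreChart_eq_comp (e : ↥s × Fin 3 ≃ Fin n) :
    gnoFibreChart s u₀ e = (fun (y : ↥s → Fin 3 → ℝ) (b : ↥s) => gnoChart (u₀ b) (y b)) ∘ regroup s e := by
  funext x
  funext b
  simp only [gnoFibreChart, Function.comp_apply, regroup_apply_eq]

/-- The gnomonic fibre chart is measure preserving from the weighted cube `e^{-jac_e} 1_{[-S,S]ⁿ} dx` to the product of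
the Haar data on the gnomonic windows. [folklore] -/
theorem measurePreserving_gnoFibreChart (e : ↥s × Fin 3 ≃ Fin n) (S : ℝ) :
    MeasurePreserving (gnoFibreChart s u₀ e) (cubeWeighted n S (gnoJac s e))
      (Measure.pi fun b : ↥s => (HaarData.haar : Measure SU2).restrict (gnoWindow (u₀ b) S)) := by
  rw [gnoFibreChart_eq_comp]
  exact (measurePreserving_pi (fun _ : ↥s => gnoMeasure S)
      (fun b : ↥s => (HaarData.haar : Measure SU2).restrict (gnoWindow (u₀ b) S))
      fun b => measurePreserving_gnoChart (u₀ b) S).comp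
    (measurePreserving_regroup_cubeWeighted e S)

variable [DecidableEq (PBond P j)]

/-- On the fibre through `s` at the exterior `u₀` the product window is the indicator of the box
`∏_{b ∈ s} gnoWindow (u₀ b) S`. [folklore] -/
theorem windowDensity_updateFinset (y : ↥s → SU2) :
    windowDensity s u₀ S (updateFinset u₀ s y) =
      (Set.pi univ fun b : ↥s => gnoWindow (u₀ b) S).indicator (fun _ => (1 : ℝ)) y := by
  unfold windowDensity
  rw [← Finset.prod_coe_sort s]
  have hb : ∀ b : ↥s, updateFinset u₀ s y (b : PBond P j) = y b := fun b => by
    simp [Function.updateFinset, b.2]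
  simp_rw [hb]
  by_cases hy : y ∈ Set.pi univ fun b : ↥s => gnoWindow (u₀ b) S
  · rw [indicator_of_mem hy]
    exact Finset.prod_eq_one fun b _ => indicator_of_mem (hy b (mem_univ _)) _
  · rw [indicator_of_notMem hy]
    simp only [mem_univ_pi, not_forall] at hy
    obtain ⟨b, hb'⟩ := hy
    exact Finset.prod_eq_zero (Finset.mem_univ b) (indicator_of_notMem hb' _)

/-- The product window is a BLIND WINDOW in the sense of `T4CubeChartTransport.mem_respDom_of_cubeChart` (binder `hbl`).
[folklore] -/
theorem windowDensity_blind (u : GaugeField P j SU2) (y : ↥s → SU2) :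
    windowDensity s u₀ S (updateFinset u s y) = windowDensity s u₀ S (updateFinset u₀ s y) :=
  windowDensity_congr fun b hb => by simp [Function.updateFinset, hb]

/-- The same, for the `ℝ≥0∞`-valued weight of `IsCubeImage`. [folklore] -/
theorem ofReal_windowDensity_updateFinset :
    (fun y : ↥s → SU2 => ENNReal.ofReal (windowDensity s u₀ S (updateFinset u₀ s y))) =
      (Set.pi univ fun b : ↥s => gnoWindow (u₀ b) S).indicator 1 := by
  funext y
  rw [windowDensity_updateFinset]
  by_cases hy : y ∈ Set.pi univ fun b : ↥s => gnoWindow (u₀ b) S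
  · rw [indicator_of_mem hy, indicator_of_mem hy, ENNReal.ofReal_one, Pi.one_apply]
  · rw [indicator_of_notMem hy, indicator_of_notMem hy, ENNReal.ofReal_zero]

/-- The windowed base law of the `SU(2)` fibre at the reference exterior is the product of the Haar data on the
gnomonic windows. [folklore] -/
theorem fibreBase_withDensity_windowDensity :
    (fibreBase s).withDensity (fun y => ENNReal.ofReal (windowDensity s u₀ S (updateFinset u₀ s y))) =
      Measure.pi fun b : ↥s => (HaarData.haar : Measure SU2).restrict (gnoWindow (u₀ b) S) := by
  rw [ofReal_windowDensity_updateFinset,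
    withDensity_indicator_one (MeasurableSet.univ_pi fun _ => measurableSet_gnoWindow)]
  exact Measure.restrict_pi_pi _ _

/-- **THE CHART HYPOTHESIS HOLDS ON THE `SU(2)` FIBRE** (caveat (CHART) of `T4CubeChartTransport`, production-type
group, gnomonic window): for every bond set `s`, reference field `u₀`, coordinate enumeration `e : s × Fin 3 ≃ Fin n`
and half-width `S > 0`, the windowed base law `χ_{s,u₀,S}(u₀←y) · Haar^s(dy)` of the fibre through `s` IS the image
under the gnomonic fibre chart `x ↦ (u₀(b) P(1, x_{e(b,·)}))_b` of the weighted cube law `e^{-jac_e} 1_{[-S,S]ⁿ} dx`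
with the smooth, NON-constant log-Jacobian `jac_e(x) = Σ_b [log(2π²) + 2 log(1 + |x_{e(b,·)}|²)]` — an instance of
`CubeChart s χ u₀ n S φ jac` with `χ` = the product gnomonic window. [folklore] -/
theorem cubeChart_specialUnitaryTwo (s : Finset (PBond P j)) (u₀ : GaugeField P j SU2) (e : ↥s × Fin 3 ≃ Fin n)
    (hS : 0 < S) :
    CubeChart s (windowDensity s u₀ S) u₀ n S (gnoFibreChart s u₀ e) (gnoJac s e) where
  S_pos := hS
  measurable_w := (measurable_windowDensity s u₀ S).comp measurable_updateFinset
  nonneg_w _ := windowDensity_nonneg _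
  measurable_φ := (measurePreserving_gnoFibreChart e S).measurable
  measurable_jac := measurable_gnoJac e
  map_eq := by
    rw [fibreBase_withDensity_windowDensity, (measurePreserving_gnoFibreChart e S).map_eq]

/-- The same with the canonical enumeration `bondCoordEquiv s` (`n = 3·#s`). [folklore] -/
theorem cubeChart_specialUnitaryTwo_card (s : Finset (PBond P j)) (u₀ : GaugeField P j SU2) (hS : 0 < S) :
    CubeChart s (windowDensity s u₀ S) u₀ (s.card * 3) S (gnoFibreChart s u₀ (bondCoordEquiv s))
      (gnoJac s (bondCoordEquiv s)) :=
  cubeChart_specialUnitaryTwo s u₀ (bondCoordEquiv s) hS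

/-- INHABITATION of the hypothesis class `CubeChart` by the production-type fibre: for every `s`, `u₀` and `S > 0` the
`SU(2)` fibre admits a cube chart in dimension `n = 3·#s`, with a smooth log-Jacobian. [folklore] -/
theorem exists_cubeChart_specialUnitaryTwo (s : Finset (PBond P j)) (u₀ : GaugeField P j SU2) (hS : 0 < S) :
    ∃ (n : ℕ) (φ : (Fin n → ℝ) → (↥s → SU2)) (jac : (Fin n → ℝ) → ℝ),
      CubeChart s (windowDensity s u₀ S) u₀ n S φ jac ∧ n = s.card * 3 ∧ ContDiff ℝ 2 jac :=
  ⟨s.card * 3, _, _, cubeChart_specialUnitaryTwo_card s u₀ hS, rfl, contDiff_gnoJac _⟩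

end Fibre

/-! ## §5  The window mass — the consumers' provisos `fibreIntegral … u₀ ≠ 0` and `χ·e^{h} ≤ C` for the gnomonic window -/

section Mass

open T4DressingDefect T4JointDressing B15.BasicStep

variable {P : Params} {j : ℕ} [DecidableEq (PBond P j)]
variable {s : Finset (PBond P j)} {u₀ : GaugeField P j SU2} {S : ℝ}

/-- The fibre law of the product gnomonic window at the reference exterior is the product of the Haar data restricted
to the windows (`T4DressingDefect.fibreLaw`). [folklore] -/
theorem fibreLaw_windowDensity :
    fibreLaw s (windowDensity s u₀ S) u₀ =
      Measure.pi fun b : ↥s => (HaarData.haar : Measure SU2).restrict (gnoWindow (u₀ b) S) := by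
  rw [fibreLaw]
  exact fibreBase_withDensity_windowDensity

/-- THE WINDOW MASS in `ℝ≥0∞`: the product over the bonds of the one-bond window masses. [folklore] -/
theorem fibreLaw_windowDensity_univ :
    fibreLaw s (windowDensity s u₀ S) u₀ Set.univ = ∏ b : ↥s, (HaarData.haar : Measure SU2) (gnoWindow (u₀ b) S) := by
  rw [fibreLaw_windowDensity, Measure.pi_univ]
  simp_rw [Measure.restrict_apply_univ]

/-- **THE WINDOW MASS**: `∫dV⌈_s χ_{s,u₀,S} (u₀) = (∫_{[-S,S]³} w)^{#s}` (`B15.BasicStep.fibreIntegral`) — the same for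
every reference field `u₀` (left invariance). [folklore] -/
theorem fibreIntegral_windowDensity (S : ℝ) :
    fibreIntegral s (windowDensity s u₀ S) u₀ = (∫ v in cube 3 S, gnoWeight v) ^ s.card := by
  rw [← toReal_fibreLaw_univ, fibreLaw_windowDensity_univ]
  simp_rw [haar_gnoWindow_eq_ofReal]
  rw [Finset.prod_const, Finset.card_univ, Fintype.card_coe, ENNReal.toReal_pow,
    ENNReal.toReal_ofReal (setIntegral_nonneg (measurableSet_cube' 3 S) fun v _ => (gnoWeight_pos v).le)]

/-- … hence `≥ ((2π²)⁻¹ (1+3S²)⁻² (2S)³)^{#s}` for `S ≥ 0`. [folklore] -/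
theorem le_fibreIntegral_windowDensity (hS : 0 ≤ S) :
    ((2 * π ^ 2)⁻¹ * ((1 + 3 * S ^ 2)⁻¹) ^ 2 * (2 * S) ^ 3) ^ s.card ≤ fibreIntegral s (windowDensity s u₀ S) u₀ := by
  rw [fibreIntegral_windowDensity]
  exact pow_le_pow_left₀ (by positivity) (le_integral_gnoWeight hS) _

/-- **THE WINDOW MASS IS POSITIVE** for `S > 0`: `0 < ∫dV⌈_s χ_{s,u₀,S} (u₀)` (`B15.BasicStep.fibreIntegral`). [folklore] -/
theorem fibreIntegral_windowDensity_pos (hS : 0 < S) : 0 < fibreIntegral s (windowDensity s u₀ S) u₀ := by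
  rw [← toReal_fibreLaw_univ, fibreLaw_windowDensity_univ]
  exact ENNReal.toReal_pos (Finset.prod_ne_zero_iff.2 fun b _ => (haar_gnoWindow_pos (u₀ b) hS).ne')
    (ENNReal.prod_ne_top fun b _ => measure_ne_top _ _)

/-- **THE CONSUMER'S PROVISO FOR THE GNOMONIC WINDOW.**  For a bounded exponent `|h| ≤ B` the Gibbs data
`χ_{s,u₀,S}·e^{h}` has POSITIVE window mass at the reference exterior (`T4JointDressing.fibreIntegral_exp_dressed_pos`).
[folklore] -/
theorem fibreIntegral_windowDensity_mul_exp_pos (hS : 0 < S) {h : Density P j SU2} {B : ℝ} (hB : ∀ U, |h U| ≤ B) :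
    0 < fibreIntegral s (fun U => windowDensity s u₀ S U * Real.exp (h U)) u₀ := by
  simpa only [one_mul] using fibreIntegral_exp_dressed_pos s h (fun U => windowDensity_nonneg U)
    (fun U => windowDensity_le_one U) hB 1 u₀ (fibreIntegral_windowDensity_pos hS).ne'

/-- … in the shape of the binder `hne : fibreIntegral s (fun U => χ U * Real.exp (h U)) u₀ ≠ 0` of
`T4CovarianceResponse.meanLipschitz_of_varianceBound` / `tiltData_fibre` and of `T4CubeChartTransport` §4. [folklore] -/
theorem fibreIntegral_windowDensity_mul_exp_ne_zero (hS : 0 < S) {h : Density P j SU2} {B : ℝ}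
    (hB : ∀ U, |h U| ≤ B) : fibreIntegral s (fun U => windowDensity s u₀ S U * Real.exp (h U)) u₀ ≠ 0 :=
  (fibreIntegral_windowDensity_mul_exp_pos hS hB).ne'

omit [DecidableEq (PBond P j)] in
/-- The bound `χ e^{h} ≤ e^{B}` (binder `hC` of the consumers) for the gnomonic window and `|h| ≤ B`. [folklore] -/
theorem windowDensity_mul_exp_le {h : Density P j SU2} {B : ℝ} (hB : ∀ U, |h U| ≤ B) (U : GaugeField P j SU2) :
    windowDensity s u₀ S U * Real.exp (h U) ≤ Real.exp B :=
  (mul_le_of_le_one_left (Real.exp_nonneg _) (windowDensity_le_one U)).trans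
    (Real.exp_le_exp.2 (abs_le.1 (hB U)).2)

end Mass

/-! ## §6  The Hessian of the gnomonic Jacobian (v1.1, row `…-CHART-SU2-JAC*`): closed form, the global bound `−½`,
and the window bound `4(1−3S²)/(1+3S²)²` — the Jacobian half of `λ` in caveat (γ) of `T4CubeChartTransport` -/

section Hessian

variable {P : Params} {j : ℕ} {s : Finset (PBond P j)} {n : ℕ}

/-- Per-bond data of the quadratic form of the Jacobian's Hessian along a direction `w` at `x`:
`a_b(x) = 1 + Σ_i x_{e(b,i)}²` (≥ 1). [folklore] -/
def blkA (e : ↥s × Fin 3 ≃ Fin n) (x : Fin n → ℝ) (b : ↥s) : ℝ := 1 + ∑ i : Fin 3, x (e (b, i)) ^ 2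

/-- `β_b(x,w) = Σ_i x_{e(b,i)} w_{e(b,i)}`. [folklore] -/
def blkB (e : ↥s × Fin 3 ≃ Fin n) (x w : Fin n → ℝ) (b : ↥s) : ℝ := ∑ i : Fin 3, x (e (b, i)) * w (e (b, i))

/-- `γ_b(w) = Σ_i w_{e(b,i)}²`. [folklore] -/
def blkC (e : ↥s × Fin 3 ≃ Fin n) (w : Fin n → ℝ) (b : ↥s) : ℝ := ∑ i : Fin 3, w (e (b, i)) ^ 2

/-- `a_b ≥ 1`. [folklore] -/
theorem one_le_blkA (e : ↥s × Fin 3 ≃ Fin n) (x : Fin n → ℝ) (b : ↥s) : 1 ≤ blkA e x b :=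
  le_add_of_nonneg_right (Finset.sum_nonneg fun _ _ => sq_nonneg _)

/-- `a_b > 0`. [folklore] -/
theorem blkA_pos (e : ↥s × Fin 3 ≃ Fin n) (x : Fin n → ℝ) (b : ↥s) : 0 < blkA e x b :=
  one_pos.trans_le (one_le_blkA e x b)

/-- `γ_b ≥ 0`. [folklore] -/
theorem blkC_nonneg (e : ↥s × Fin 3 ≃ Fin n) (w : Fin n → ℝ) (b : ↥s) : 0 ≤ blkC e w b :=
  Finset.sum_nonneg fun _ _ => sq_nonneg _

/-- Cauchy–Schwarz in the bond block: `β_b² ≤ (a_b − 1)·γ_b`. [folklore] -/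
theorem blkB_sq_le (e : ↥s × Fin 3 ≃ Fin n) (x w : Fin n → ℝ) (b : ↥s) :
    blkB e x w b ^ 2 ≤ (blkA e x b - 1) * blkC e w b := by
  rw [blkA, add_sub_cancel_left]
  unfold blkB blkC
  exact Finset.sum_mul_sq_le_sq_mul_sq _ _ _

/-- `Σ_b γ_b(w) = w·w` (the enumeration `e` is a bijection `s × Fin 3 ≃ Fin n`). [folklore] -/
theorem sum_blkC (e : ↥s × Fin 3 ≃ Fin n) (w : Fin n → ℝ) : ∑ b : ↥s, blkC e w b = w ⬝ᵥ w := by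
  calc ∑ b : ↥s, blkC e w b = ∑ p : ↥s × Fin 3, w (e p) ^ 2 := by rw [Fintype.sum_prod_type]; rfl
    _ = ∑ k : Fin n, w k ^ 2 := e.sum_comp (fun k => w k ^ 2)
    _ = w ⬝ᵥ w := by simp [dotProduct, pow_two]

/-- On the cube `[-S,S]ⁿ`: `a_b(x) ≤ 1 + 3S²`. [folklore] -/
theorem blkA_le_of_mem_cube (e : ↥s × Fin 3 ≃ Fin n) {S : ℝ} {x : Fin n → ℝ} (hx : x ∈ cube n S) (b : ↥s) :
    blkA e x b ≤ 1 + 3 * S ^ 2 := by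
  rw [mem_cube_iff] at hx
  have h3 : ∑ i : Fin 3, x (e (b, i)) ^ 2 ≤ ∑ _i : Fin 3, S ^ 2 :=
    Finset.sum_le_sum fun i _ => sq_le_sq' (abs_le.1 (hx _)).1 (abs_le.1 (hx _)).2
  rw [Finset.sum_const, Finset.card_univ, Fintype.card_fin, nsmul_eq_mul, Nat.cast_ofNat] at h3
  unfold blkA
  linarith

/-- The block quadratic `a_b + 2β_b t + γ_b t² = 1 + Σ_i (x_{e(b,i)} + t w_{e(b,i)})²`. [folklore] -/
theorem blk_quad_eq (e : ↥s × Fin 3 ≃ Fin n) (x w : Fin n → ℝ) (b : ↥s) (t : ℝ) :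
    blkA e x b + 2 * blkB e x w b * t + blkC e w b * t ^ 2 = 1 + ∑ i : Fin 3, (x (e (b, i)) + t * w (e (b, i))) ^ 2 := by
  have h : ∀ i : Fin 3, (x (e (b, i)) + t * w (e (b, i))) ^ 2
      = x (e (b, i)) ^ 2 + 2 * (x (e (b, i)) * w (e (b, i))) * t + w (e (b, i)) ^ 2 * t ^ 2 := fun i => by ring
  simp only [h, Finset.sum_add_distrib, ← Finset.sum_mul, ← Finset.mul_sum, blkA, blkB, blkC]
  ring

/-- The block quadratic is positive (`≥ 1`). [folklore] -/
theorem blk_quad_pos (e : ↥s × Fin 3 ≃ Fin n) (x w : Fin n → ℝ) (b : ↥s) (t : ℝ) :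
    0 < blkA e x b + 2 * blkB e x w b * t + blkC e w b * t ^ 2 := by
  rw [blk_quad_eq]; positivity

/-- **THE JACOBIAN ALONG A LINE**: `jac_e(x + t w) = Σ_b [log 2π² + 2 log(a_b + 2β_b t + γ_b t²)]`. [folklore] -/
theorem gnoJac_add_smul (e : ↥s × Fin 3 ≃ Fin n) (x w : Fin n → ℝ) (t : ℝ) :
    gnoJac s e (x + t • w)
      = ∑ b : ↥s, (Real.log (2 * π ^ 2) + 2 * Real.log (blkA e x b + 2 * blkB e x w b * t + blkC e w b * t ^ 2)) := by
  unfold gnoJac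
  refine Finset.sum_congr rfl fun b _ => ?_
  rw [blk_quad_eq]
  simp only [Pi.add_apply, Pi.smul_apply, smul_eq_mul]

/-- The block quadratic has derivative `2β_b + 2γ_b t`. [folklore] -/
theorem hasDerivAt_blk_quad (e : ↥s × Fin 3 ≃ Fin n) (x w : Fin n → ℝ) (b : ↥s) (t : ℝ) :
    HasDerivAt (fun t => blkA e x b + 2 * blkB e x w b * t + blkC e w b * t ^ 2)
      (2 * blkB e x w b + 2 * blkC e w b * t) t := by
  have hsq : HasDerivAt (fun t : ℝ => t ^ 2) (2 * t) t := (hasDerivAt_pow 2 t).congr_deriv (by norm_num)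
  have h := (((hasDerivAt_const t (blkA e x b)).fun_add ((hasDerivAt_id' t).const_mul (2 * blkB e x w b))).fun_add
    (hsq.const_mul (blkC e w b)))
  exact h.congr_deriv (by ring)

/-- **FIRST DERIVATIVE ALONG THE LINE**: `d/dt jac_e(x + t w) = Σ_b 2(2β_b + 2γ_b t)/(a_b + 2β_b t + γ_b t²)`. [folklore] -/
theorem hasDerivAt_gnoJac_line (e : ↥s × Fin 3 ≃ Fin n) (x w : Fin n → ℝ) (t : ℝ) :
    HasDerivAt (fun t => gnoJac s e (x + t • w))
      (∑ b : ↥s, 2 * ((2 * blkB e x w b + 2 * blkC e w b * t)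
        / (blkA e x b + 2 * blkB e x w b * t + blkC e w b * t ^ 2))) t := by
  have hfun : (fun t => gnoJac s e (x + t • w)) = fun t => ∑ b : ↥s,
      (Real.log (2 * π ^ 2) + 2 * Real.log (blkA e x b + 2 * blkB e x w b * t + blkC e w b * t ^ 2)) :=
    funext (gnoJac_add_smul e x w)
  rw [hfun]
  refine HasDerivAt.fun_sum fun b _ => ?_
  have hlog := ((hasDerivAt_blk_quad e x w b t).log (blk_quad_pos e x w b t).ne').const_mul 2
  exact hlog.const_add (Real.log (2 * π ^ 2))

/-- Chain rule: `d/dt jac_e(x + t w) = D jac_e(x + t w)(w)`. [folklore] -/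
theorem hasDerivAt_gnoJac_line_fderiv (e : ↥s × Fin 3 ≃ Fin n) (x w : Fin n → ℝ) (t : ℝ) :
    HasDerivAt (fun t => gnoJac s e (x + t • w)) (fderiv ℝ (gnoJac s e) (x + t • w) w) t := by
  have hl : HasDerivAt (fun t : ℝ => x + t • w) w t := by
    simpa using ((hasDerivAt_id t).smul_const w).const_add x
  have hd : Differentiable ℝ (gnoJac s e) := (contDiff_gnoJac e (m := 1)).differentiable (by norm_num)
  exact (hd (x + t • w)).hasFDerivAt.comp_hasDerivAt t hl

/-- **`D jac_e(x + t w)(w)` IN CLOSED FORM.** [folklore] -/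
theorem fderiv_gnoJac_line (e : ↥s × Fin 3 ≃ Fin n) (x w : Fin n → ℝ) (t : ℝ) :
    fderiv ℝ (gnoJac s e) (x + t • w) w
      = ∑ b : ↥s, 2 * ((2 * blkB e x w b + 2 * blkC e w b * t)
        / (blkA e x b + 2 * blkB e x w b * t + blkC e w b * t ^ 2)) :=
  (hasDerivAt_gnoJac_line_fderiv e x w t).unique (hasDerivAt_gnoJac_line e x w t)

/-- The closed form of `t ↦ D jac_e(x + t w)(w)` has derivative `Σ_b [4γ_b/a_b − 8β_b²/a_b²]` at `t = 0`. [folklore] -/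
theorem hasDerivAt_fderiv_gnoJac_line_zero (e : ↥s × Fin 3 ≃ Fin n) (x w : Fin n → ℝ) :
    HasDerivAt (fun t : ℝ => fderiv ℝ (gnoJac s e) (x + t • w) w)
      (∑ b : ↥s, (4 * blkC e w b / blkA e x b - 8 * blkB e x w b ^ 2 / blkA e x b ^ 2)) 0 := by
  have hfun : (fun t : ℝ => fderiv ℝ (gnoJac s e) (x + t • w) w) = fun t => ∑ b : ↥s,
      2 * ((2 * blkB e x w b + 2 * blkC e w b * t) / (blkA e x b + 2 * blkB e x w b * t + blkC e w b * t ^ 2)) :=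
    funext (fderiv_gnoJac_line e x w)
  rw [hfun]
  refine HasDerivAt.fun_sum fun b _ => ?_
  have hnum : HasDerivAt (fun t : ℝ => 2 * blkB e x w b + 2 * blkC e w b * t) (2 * blkC e w b * 1) 0 :=
    ((hasDerivAt_id' (0 : ℝ)).const_mul (2 * blkC e w b)).const_add (2 * blkB e x w b)
  have hden := hasDerivAt_blk_quad e x w b 0
  have hne : blkA e x b + 2 * blkB e x w b * 0 + blkC e w b * 0 ^ 2 ≠ 0 := (blk_quad_pos e x w b 0).ne'
  have ha : blkA e x b ≠ 0 := (blkA_pos e x b).ne'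
  have h := (hnum.fun_div hden hne).const_mul 2
  refine h.congr_deriv ?_
  have hq0 : blkA e x b + 2 * blkB e x w b * 0 + blkC e w b * 0 ^ 2 = blkA e x b := by ring
  rw [hq0]
  field_simp
  ring

/-- `t ↦ D jac_e(x + t w)(w)` has derivative `D² jac_e(x)(w,w)` at `t = 0` (the technique of the tree's
`le_fderiv_fderiv_of_uniformConvex`). [folklore] -/
theorem hasDerivAt_fderiv_gnoJac_line_fderiv₂ (e : ↥s × Fin 3 ≃ Fin n) (x w : Fin n → ℝ) :
    HasDerivAt (fun t : ℝ => fderiv ℝ (gnoJac s e) (x + t • w) w) (fderiv ℝ (fderiv ℝ (gnoJac s e)) x w w) 0 := by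
  have hF : ContDiff ℝ 2 (gnoJac s e) := contDiff_gnoJac e
  have hdiff : Differentiable ℝ (fderiv ℝ (gnoJac s e)) :=
    (hF.fderiv_right (m := 1) (by norm_num)).differentiable (by norm_num)
  have hl : HasDerivAt (fun t : ℝ => x + t • w) w 0 := by
    simpa using ((hasDerivAt_id (0 : ℝ)).smul_const w).const_add x
  have hG : HasFDerivAt (fderiv ℝ (gnoJac s e)) (fderiv ℝ (fderiv ℝ (gnoJac s e)) x) (x + (0 : ℝ) • w) := by
    rw [zero_smul, add_zero]; exact (hdiff x).hasFDerivAt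
  have hG' : HasDerivAt (fun t : ℝ => fderiv ℝ (gnoJac s e) (x + t • w)) (fderiv ℝ (fderiv ℝ (gnoJac s e)) x w) 0 :=
    hG.comp_hasDerivAt (0 : ℝ) hl
  have := hG'.clm_apply (hasDerivAt_const (0 : ℝ) w)
  simpa using this

/-- **(J1) THE HESSIAN OF THE GNOMONIC JACOBIAN IN CLOSED FORM**:
`D² jac_e(x)(w,w) = Σ_b [4γ_b/a_b − 8β_b²/a_b²]` — block-diagonal over bonds; per block the Hessian of
`v ↦ 2 log(1+|v|²)` has radial eigenvalue `4(1−|v|²)/(1+|v|²)²` and tangential eigenvalues `4/(1+|v|²)`. [folklore] -/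
theorem fderiv_fderiv_gnoJac (e : ↥s × Fin 3 ≃ Fin n) (x w : Fin n → ℝ) :
    fderiv ℝ (fderiv ℝ (gnoJac s e)) x w w
      = ∑ b : ↥s, (4 * blkC e w b / blkA e x b - 8 * blkB e x w b ^ 2 / blkA e x b ^ 2) :=
  (hasDerivAt_fderiv_gnoJac_line_fderiv₂ e x w).unique (hasDerivAt_fderiv_gnoJac_line_zero e x w)

/-- At the centre of the window the Hessian is `4·1`: `D² jac_e(0)(w,w) = 4 |w|²`. [folklore] -/
theorem fderiv_fderiv_gnoJac_zero (e : ↥s × Fin 3 ≃ Fin n) (w : Fin n → ℝ) :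
    fderiv ℝ (fderiv ℝ (gnoJac s e)) 0 w w = 4 * (w ⬝ᵥ w) := by
  rw [fderiv_fderiv_gnoJac, ← sum_blkC e w, Finset.mul_sum]
  refine Finset.sum_congr rfl fun b _ => ?_
  simp [blkA, blkB]

/-- Per block, after Cauchy–Schwarz: `4γ/a − 8β²/a² ≥ 4γ(2−a)/a²`. [folklore] -/
theorem blk_hess_ge (e : ↥s × Fin 3 ≃ Fin n) (x w : Fin n → ℝ) (b : ↥s) :
    4 * blkC e w b * (2 - blkA e x b) / blkA e x b ^ 2
      ≤ 4 * blkC e w b / blkA e x b - 8 * blkB e x w b ^ 2 / blkA e x b ^ 2 := by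
  have ha := blkA_pos e x b
  have hcs := blkB_sq_le e x w b
  rw [div_sub_div _ _ ha.ne' (pow_ne_zero 2 ha.ne'), div_le_div_iff₀ (pow_pos ha 2) (mul_pos ha (pow_pos ha 2))]
  nlinarith [mul_nonneg (mul_nonneg ha.le (pow_nonneg ha.le 2)) (sub_nonneg.2 hcs), pow_pos ha 2, pow_pos ha 3]

/-- The elementary inequality behind the GLOBAL bound: `4γ(2−a)/a² ≥ −γ/2` for `a > 0`, `γ ≥ 0` (`(a−4)² ≥ 0`). [folklore] -/
theorem blk_global_ge {a c : ℝ} (ha : 0 < a) (hc : 0 ≤ c) : -(1 / 2) * c ≤ 4 * c * (2 - a) / a ^ 2 := by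
  rw [le_div_iff₀ (pow_pos ha 2)]
  nlinarith [mul_nonneg hc (sq_nonneg (a - 4))]

/-- The elementary monotonicity behind the WINDOW bound: `a ↦ (2−a)/a²` is decreasing on `[1,4]`. [folklore] -/
theorem ratio_anti {a A : ℝ} (ha : 1 ≤ a) (haA : a ≤ A) (hA : A ≤ 4) : (2 - A) / A ^ 2 ≤ (2 - a) / a ^ 2 := by
  have ha0 : 0 < a := one_pos.trans_le ha
  have hA0 : 0 < A := ha0.trans_le haA
  rw [div_le_div_iff₀ (pow_pos hA0 2) (pow_pos ha0 2)]
  nlinarith [mul_nonneg (mul_nonneg (sub_nonneg.2 haA) ha0.le) (sub_nonneg.2 hA), sq_nonneg (A - a)]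

/-- **(J2) THE GLOBAL HESSIAN BOUND**: `D² jac_e(x)(w,w) ≥ −½ |w|²` for all `x, w` — sharp (attained when one block has
`|x_{e(b,·)}|² = 3` and `w ∥ x` there). [folklore] -/
theorem neg_half_mul_le_fderiv_fderiv_gnoJac (e : ↥s × Fin 3 ≃ Fin n) (x w : Fin n → ℝ) :
    -(1 / 2) * (w ⬝ᵥ w) ≤ fderiv ℝ (fderiv ℝ (gnoJac s e)) x w w := by
  rw [fderiv_fderiv_gnoJac, ← sum_blkC e w, Finset.mul_sum]
  exact Finset.sum_le_sum fun b _ =>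
    (blk_global_ge (blkA_pos e x b) (blkC_nonneg e w b)).trans (blk_hess_ge e x w b)

/-- **(J2′) in the consumer's currency**: `T4CubePoincare.HessianBound (gnoJac s e) (−½)`. [folklore] -/
theorem hessianBound_gnoJac (e : ↥s × Fin 3 ≃ Fin n) : HessianBound (gnoJac s e) (-(1 / 2)) :=
  (hessianBound_iff_fderiv (contDiff_gnoJac e)).2 (neg_half_mul_le_fderiv_fderiv_gnoJac e)

/-- **(J3) THE WINDOW BOUND**: on the cube `[-S,S]ⁿ` with `S ≤ 1`,
`D² jac_e(x)(w,w) ≥ 4(1−3S²)/(1+3S²)² · |w|²` — POSITIVE for `3S² < 1` (the Jacobian HELPS the concavity modulus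
`λ` of caveat (γ) of `T4CubeChartTransport` on small windows), `= 4|w|²` at the centre. [folklore] -/
theorem window_mul_le_fderiv_fderiv_gnoJac (e : ↥s × Fin 3 ≃ Fin n) {S : ℝ} (hS1 : S ≤ 1) {x : Fin n → ℝ}
    (hx : x ∈ cube n S) (w : Fin n → ℝ) :
    4 * (1 - 3 * S ^ 2) / (1 + 3 * S ^ 2) ^ 2 * (w ⬝ᵥ w) ≤ fderiv ℝ (fderiv ℝ (gnoJac s e)) x w w := by
  rw [fderiv_fderiv_gnoJac, ← sum_blkC e w, Finset.mul_sum]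
  refine Finset.sum_le_sum fun b _ => (le_trans ?_ (blk_hess_ge e x w b))
  have hS0 : 0 ≤ S := (abs_nonneg _).trans (mem_cube_iff.1 hx (e (b, 0)))
  have hA4 : 1 + 3 * S ^ 2 ≤ 4 := by nlinarith [mul_nonneg hS0 (sub_nonneg.2 hS1)]
  have hr := ratio_anti (one_le_blkA e x b) (blkA_le_of_mem_cube e hx b) hA4
  have hc := blkC_nonneg e w b
  have h1 : 4 * (1 - 3 * S ^ 2) / (1 + 3 * S ^ 2) ^ 2 * blkC e w b
      = 4 * blkC e w b * ((2 - (1 + 3 * S ^ 2)) / (1 + 3 * S ^ 2) ^ 2) := by ring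
  have h2 : 4 * blkC e w b * (2 - blkA e x b) / blkA e x b ^ 2
      = 4 * blkC e w b * ((2 - blkA e x b) / blkA e x b ^ 2) := by ring
  rw [h1, h2]
  exact mul_le_mul_of_nonneg_left hr (by positivity)

end Hessian

/-! ## §7  The `SU(2)` plug with ACTION-ONLY convexity inputs (v1.2, row `…-CHART-SU2-PLUG*`)

APPEND-ONLY over v1.1 (p187099).  The consumer `T4CubeChartTransport.mem_respDom_of_cubeChart` asks its modulus `λ > 0` of
`C²` representatives `fᵢ` (on `ℝⁿ`) of the WHOLE transported exponents `jac − h(uᵢ ←_s φ x)` on the cube.  For the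
gnomonic `SU(2)` chart §6 bounds the Jacobian half GLOBALLY, `HessianBound (gnoJac s e) (−½)`; Hessian lower bounds add
(`hessianBound_add`), so `C²` representatives `gᵢ` of the ACTION `x ↦ −h(uᵢ ←_s φ x)` on the cube with
`HessianBound gᵢ μ` give `fᵢ := gnoJac s e + gᵢ` with `HessianBound fᵢ (μ − ½)` (`hessianBound_gnoJac_add`), and for
`μ > ½` the plug applies with `λ = μ − ½`; the chart-side binders `hc`, `hχm`, `hχ0`, `hbl` of the plug are the theorems
`cubeChart_specialUnitaryTwo`, `measurable_windowDensity`, `windowDensity_nonneg`, `windowDensity_blind` of §4, and the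
gap-gradient binder is unchanged because `f₁ − f₀ = g₁ − g₀` identically.  Nothing here sizes `μ` (Bałaban-side, caveat
(γ) of `T4CubeChartTransport`); the window-local constant of §6 is not used (that would need (EXT)). [folklore]
-/

section Plug

open Literature.Probability.Distributions (coordGradient)
open T4CovarianceResponse (respDom)

variable {P : Params} {j : ℕ} {s : Finset (PBond P j)} {n : ℕ}

/-- **Additivity of Hessian lower bounds**: for `C²` functions `f, g` on `ℝⁿ`, `Hess f ≥ λ` and `Hess g ≥ μ` give
`Hess (f + g) ≥ λ + μ` (`T4CubePoincare.HessianBound`; by `T4CubePoincare.fderiv_fderiv_combo` with `a = b = 1`).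
[folklore] -/
theorem hessianBound_add {f g : (Fin n → ℝ) → ℝ} (hf : ContDiff ℝ 2 f) (hg : ContDiff ℝ 2 g) {lam mu : ℝ}
    (hBf : HessianBound f lam) (hBg : HessianBound g mu) : HessianBound (fun y => f y + g y) (lam + mu) := by
  have hfg : (fun y => f y + g y) = fun y => 1 * f y + 1 * g y := funext fun y => by ring
  rw [hfg, hessianBound_iff_fderiv (contDiff_combo hf hg 1 1)]
  intro x w
  rw [fderiv_fderiv_combo hf hg, one_mul, one_mul, add_mul]
  exact add_le_add ((hessianBound_iff_fderiv hf).1 hBf x w) ((hessianBound_iff_fderiv hg).1 hBg x w)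

/-- `gnoJac s e + g` is `C^m` for `C^m` `g`. [folklore] -/
theorem contDiff_gnoJac_add (e : ↥s × Fin 3 ≃ Fin n) {g : (Fin n → ℝ) → ℝ} {m : WithTop ℕ∞}
    (hg : ContDiff ℝ m g) : ContDiff ℝ m (fun x => gnoJac s e x + g x) :=
  (contDiff_gnoJac e).add hg

/-- **The Jacobian half of `λ` absorbed**: if a `C²` function `g` on `ℝⁿ` has `Hess g ≥ μ`, then
`Hess (gnoJac s e + g) ≥ μ − ½` (`hessianBound_gnoJac` of §6 + `hessianBound_add`). [folklore] -/
theorem hessianBound_gnoJac_add (e : ↥s × Fin 3 ≃ Fin n) {g : (Fin n → ℝ) → ℝ} (hg : ContDiff ℝ 2 g) {mu : ℝ}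
    (hB : HessianBound g mu) : HessianBound (fun x => gnoJac s e x + g x) (mu - 1 / 2) := by
  rw [show mu - 1 / 2 = -(1 / 2) + mu by ring]
  exact hessianBound_add (contDiff_gnoJac e) hg (hessianBound_gnoJac e) hB

variable [DecidableEq (PBond P j)] {u₀ : GaugeField P j SU2} {S : ℝ}

/-- **THE `SU(2)` PLUG WITH ACTION-ONLY CONVEXITY INPUTS.**  `T4CubeChartTransport.mem_respDom_of_cubeChart` for the
gnomonic `SU(2)` chart at `u₀` (relabelling `e`, half-width `S > 0`): for a measurable exponent `h` with
`windowDensity·e^{h} ≤ C` (e.g. `windowDensity_mul_exp_le` for bounded `h`), an exterior `u` with `K`-bounded gap on the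
fibre, `0 ≤ dev u`, a modulus `μ > ½`, `C²` representatives `g₀, g₁` on `ℝⁿ` of the ACTIONS `x ↦ −h(u₀ ←_s φ x)`,
`x ↦ −h(u ←_s φ x)` on the cube `[-S,S]ⁿ` with `HessianBound gᵢ μ`, the gap-gradient bound `|∇(g₁ − g₀)|² ≤ (b_H·dev u)²`
on the cube, and `C¹` representatives of the real inserts `B · b` (`b ∈ T`) with `|∇|² ≤ L²` on the cube:
`u ∈ respDom s (windowDensity s u₀ S) h u₀ B T dev (b_H/√(μ−½)) (L/√(μ−½))` — the Jacobian half of the consumer's `λ`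
is paid by §6 (`λ = μ − ½`). [folklore] -/
theorem mem_respDom_of_gnoChart {β : Type*} (e : ↥s × Fin 3 ≃ Fin n) (hS : 0 < S) {h : Density P j SU2}
    (hhm : Measurable h) {C : ℝ} (hC : ∀ U, windowDensity s u₀ S U * Real.exp (h U) ≤ C)
    {u : GaugeField P j SU2} {K : ℝ}
    (hK : ∀ y : ↥s → SU2, |h (updateFinset u₀ s y) - h (updateFinset u s y)| ≤ K)
    {dev : GaugeField P j SU2 → ℝ} (hdev : 0 ≤ dev u) {mu : ℝ} (hmu : 1 / 2 < mu)
    {g₀ g₁ : (Fin n → ℝ) → ℝ} (hg₀ : ContDiff ℝ 2 g₀) (hg₁ : ContDiff ℝ 2 g₁)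
    (hB₀ : HessianBound g₀ mu) (hB₁ : HessianBound g₁ mu)
    (agree₀ : ∀ x ∈ cube n S, g₀ x = -h (updateFinset u₀ s (gnoFibreChart s u₀ e x)))
    (agree₁ : ∀ x ∈ cube n S, g₁ x = -h (updateFinset u s (gnoFibreChart s u₀ e x))) {bH : ℝ}
    (hgap : ∀ x ∈ cube n S,
      coordGradient (fun x => g₁ x - g₀ x) x ⬝ᵥ coordGradient (fun x => g₁ x - g₀ x) x ≤ (bH * dev u) ^ 2)
    {B : (↥s → SU2) → β → ℝ} {T : Finset β} (hBm : ∀ b ∈ T, Measurable fun y => B y b) {L : ℝ}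
    (hBg : ∀ b ∈ T, ∃ g : (Fin n → ℝ) → ℝ, ContDiff ℝ 1 g ∧
      (∀ x ∈ cube n S, g x = B (gnoFibreChart s u₀ e x) b) ∧
      ∀ x ∈ cube n S, coordGradient g x ⬝ᵥ coordGradient g x ≤ L ^ 2) :
    u ∈ respDom s (windowDensity s u₀ S) h u₀ B T dev (bH / Real.sqrt (mu - 1 / 2))
      (L / Real.sqrt (mu - 1 / 2)) := by
  have hfg : (fun x => gnoJac s e x + g₁ x - (gnoJac s e x + g₀ x)) = fun x => g₁ x - g₀ x :=
    funext fun x => by ring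
  refine mem_respDom_of_cubeChart (f₀ := fun x => gnoJac s e x + g₀ x) (f₁ := fun x => gnoJac s e x + g₁ x)
    (cubeChart_specialUnitaryTwo s u₀ e hS) (measurable_windowDensity s u₀ S) hhm windowDensity_nonneg hC
    (windowDensity_blind u) hK hdev (sub_pos.2 hmu) (contDiff_gnoJac_add e hg₀) (contDiff_gnoJac_add e hg₁)
    (hessianBound_gnoJac_add e hg₀ hB₀) (hessianBound_gnoJac_add e hg₁ hB₁) (fun x hx => ?_) (fun x hx => ?_)
    (fun x hx => ?_) hBm hBg
  · show gnoJac s e x + g₀ x = _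
    rw [agree₀ x hx]; ring
  · show gnoJac s e x + g₁ x = _
    rw [agree₁ x hx]; ring
  · show coordGradient (fun y => gnoJac s e y + g₁ y - (gnoJac s e y + g₀ y)) x ⬝ᵥ
        coordGradient (fun y => gnoJac s e y + g₁ y - (gnoJac s e y + g₀ y)) x ≤ (bH * dev u) ^ 2
    rw [hfg]
    exact hgap x hx

end Plug

end Literature.MathematicalPhysics.QuantumFieldTheory.Balaban1983to89.T4CubeChartGnomonic

end
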